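/-
Copyright: cell `langlands-arthur-audit` (papers/Langlands/langlands-arthur-audit), unit `pub-arthur-down-g28`
(downstream tracer, gen 28).  Fourteenth file of the downstream register (module M160 of the cell's MODULE-MAP): `Downstream.lean`
(tranches 1–4) … `Downstream12.lean` (49–52), `Downstream13.lean` (53–54; 143,185 bytes = 72 % of the gate's 200 000-byte file
cap after v2 = p246492) are full or nearly so, so the register continues here, APPEND-ONLY in the same conventions and the same
namespace `…Arthur2013.Downstream`; v1 = the fifty-fifth tranche (`Consumers55`: COUNTING THE LOCAL ARTHUR PACKETS THROUGH A
REPRESENTATION AND THROUGH ITS THETA LIFTS — A. Hazeltine – B. Liu – C.-H. Lo, arXiv:2404.05773 (row B91 `HLLenhancedShahidi`: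
the enhanced Shahidi conj. for Sp_2n and split SO_2n+1, unramified representations of Arthur type, global consequences), the
NODE `HLLtheta` (Hazeltine – Liu – Lo, *On the intersection of local Arthur packets under the theta correspondence*, 2026
preprint, not public), A. Hazeltine – A. Kumar – A. Tung, arXiv:2602.13090 (row B22 `HKTfixedTempered`: the number of packets
containing a tempered representation) and arXiv:2607.23885 (row B63 `HKTbeyondAdams`: the number of packets containing its
theta lifts on the going-up tower); `Implications55`; bookkeeping theorems); v2 (same unit, APPEND-ONLY) = the fifty-sixth
tranche (`Consumers56`: THETA AS A SUPPLIER — R. Chen – J. Zou, Selecta Math. 27 (2021) (row A9 `ChenZouLLCO`: the LLC for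
all even orthogonal groups, transported from the book's LLC for Sp_2n), R. Chen – J. Zou, arXiv:2104.12354 (row A11
`ChenZouThetaPackets`: the θ-packets of even orthogonal and unitary groups are independent of the dual pair and equal Arthur's /
Mok's packets in the quasi-split case — Adams' prediction in the stable range), H. Atobe, Math. Ann. 371 (2018) (row B12
`AtobeFJ` under its printed hypotheses `AtobeFJHyp`); `Implications56`; bookkeeping theorems); v3 (unit `pub-arthur-down-g29`,
APPEND-ONLY) = the fifty-seventh tranche (`Consumers57`: THE METAPLECTIC LINE, II — the theta-theoretic LLC for Mp_2n and its
intertwining relation: W. T. Gan – G. Savin, Compos. Math. 148 (2012) (NEW row B112: Cor. 1.2 `GanSavinLLCMp` under the node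
`LLCoddSO`, Thm 1.5 = Thm 12.1 `GanSavinPsi` under `LLCoddSO` and the node `GSHypBC`), H. Ishimoto, Compos. Math. 156 (2020)
(row B8: the LIR for Mp_2n `IshimotoLIRMp` under the node `LIRoddSO`), W.-W. Li, Front. Math. (2026) (row B57 `LiPsiVariation`),
two supply edges for the nodes typed from printed supplier sentences; `Implications57`; bookkeeping theorems); v4 (same unit,
APPEND-ONLY) = the fifty-eighth tranche (`Consumers58`: THE METAPLECTIC LINE, III — global consumers of Gan – Ichino's
Shimura – Waldspurger theorems: C. Wu, J. Number Theory 241 (2022) (row C77 `WuMpChiB` ⇐ C1), H. Ishimoto, Math. Ann. 383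
(2022) and arXiv:2312.06921 (rows C39 `IshimotoIbukiyama`, C121 `IshimotoIbukiyamaDS` ⇐ book ∧ C2), and the NEW book row C201
(W. T. Gan – B. Wang, Adv. Math. 494 (2026) `GanWangPeriod` ⇐ book); `Implications58`; bookkeeping theorems).  Nothing of the
first thirteen files is redeclared or changed.
-/
import HarnessLib
import Literature.NumberTheory.Automorphic.Arthur2013.Downstream13

/-!
# Downstream of Arthur (2013), Mok (2015), KMSW (2014): the typed register, fourteenth file (tranches ≥ 55)

**What is reproduced.**  As in the first thirteen files: for published theorems that invoke J. Arthur, *The Endoscopic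
Classification of Representations* (AMS Colloq. Publ. 61, 2013) [cite: Arthur2013], C. P. Mok's memoir [cite: Mok2012] or
Kaletha – Mínguez – Shin – White [claim: KalethaMinguezShinWhite2014, under-review], one HYPOTHESIS `E_…` per statement
quoting the sentences in which the paper invokes them (or invokes an already-typed consumer), recording WHICH leaves and
nodes of the three dependency DAGs the proof consumes; and bookkeeping theorems composing these hypotheses with the packaged
inputs `BookInputs`, `MokInputs`, `KMSWInputs` of `Downstream.lean`, so that the kernel displays the 2026 leaves each
downstream theorem rests on.  Quotations are exact substrings of the cell's texts, staged byte-identically with sha256 under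
`HOME/pub-arthur-down-g28/primaries/` (the arXiv PDF texts `paper:arxiv-2404.05773` (B91, v3, 28 pp.) and `paper:arxiv-2607.23885`
(B63, 61 pp.); the corpus TeX rendering `paper:arxiv-2602.13090` (B22, 43 chunks); locators `pNNNN:Ln` = page / chunk file
and line).  Sentences that name a conj. (the Adams conj., the enhanced Shahidi conj., the Ramanujan conj., Clozel's) or are
bibliography entries are Lean `--` comments, cited by locator.  The census rows under test: `DOWNSTREAM.md` B22 l.253 `[g3]`,
B63 l.537 `[g6]`, B91 l.765 `[g14b]`.  Block `[g28b]` of `DOWNSTREAM2.md` (this tranche).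

**Why a fifty-fifth tranche: counting packets, before and after theta.**  Tranche 54 (`Downstream13.lean` v2) typed the
Adams line — the theorems saying WHEN the p-adic theta lift of a member of Π_ψ lies in Π_{ψ_α} (B110 Mœglin 2011, B93
Bakić – Hanzer, B92 Hazeltine, B62 J. Chen).  Its 2026 continuation asks HOW MANY local Arthur packets contain a given
representation and how that number changes under the theta lifts of the going-up tower: B22 (Hazeltine – Kumar – Tung,
*On Arthur packets containing a fixed tempered representation*: p0003:L15-16 "Theorem 1.2 (Theorem (thm-count-temp)). For certain irreducible tempered representations $\pi$, there is a recursive formula for determining the number of local Arthur packets which contain $\pi$.") and B63 (the same authors, *Beyond the Adams conj.*: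
p0003:L57-59 "Theorem 1.4(Theorem 4.11).In six cases, we determine a recursive formula for |Ψ(θup −mup,α(π)(π))|."), both resting on
Atobe's extended multi-segments (row B5), the intersection theory of Hazeltine – Liu – Lo (row B101 `HLL`) AND on its sequel
« under the theta correspondence » — a 2026 preprint that is not public (the [HLL25] of B22, the [23] of B63; typed as the
NODE `HLLtheta`, no supplier edge), on C168's reduction to good parity, B75's multiplicity one, and — B63 — on the whole Adams
line of tranche 54 (B110 = « [31, Theorem 6.1] », B93 = « [8, Theorem 2] », B92 = « [18, Lemma 2.33] », Atobe – Gan for the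
first occurrence) and on row B91 (Hazeltine – Liu – Lo, the enhanced Shahidi conj. for Sp_2n / split SO_2n+1 and the
unramified representations of Arthur type, with GLOBAL corollaries through the book's Theorem 1.5.2 — graded `[g14b]`, typed
here: ⇐ book ∧ B101 ∧ B5 ∧ Atobe (Crelle 804) ∧ B75 ∧ C168 ∧ B72 ∧ B2 ∧ B71).  THE POINT FOR THE CENSUS (kernel,
`DownstreamSupport6.lean` §58): as typed all three statements are BOOK statements — support = all 24 leaves of the book's
DAG modulo B75's printed node, no Mok / KMSW leaf — and B22 / B63 rest in addition on the unpublished node `HLLtheta`; none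
of the three papers prints a conditionality sentence (B22's Remark 2.21, in a line comment below, records that the
existence of the packets for non-quasi-split groups « currently remains » open — the reason its pure-inner-form cases
carry « extra assumptions »).

**Deliberately not here.**  Any claim about the content or truth of a packet identity or of a count; the combinatorics of
extended multi-segments (Arthur-free once the parametrisation is granted) is absorbed, as are Atobe – Mínguez's
derivatives, the classification of generic representations (Muić, Jiang – Soudry, Liu), Howe duality (Waldspurger,
Gan – Takeda, Gan – Sun), Kudla, Sun – Zhu; no Mathlib, no `axiom`, no `sorry`, no `opaque`.  Bib keys
HazeltineLiuLo2024Shahidi, HazeltineKumarTung2026Fixed, HazeltineKumarTung2026Beyond added by this unit; HazeltineLiuLo2022,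
Atobe2023WhichPackets, Moeglin2011Image, Moeglin2011Adams, BakicHanzer2022Adams, Hazeltine2024Adams, AtobeGan2017, Arthur2013
exist.

**v2: theta as a supplier (fifty-sixth tranche, same unit).**  The theta correspondence does not only CONSUME the
classification (tranches 54–55); it TRANSPORTS it to groups the book does not cover.  Typed here: row A9 (R. Chen – J. Zou,
*Local Langlands correspondence for even orthogonal groups via theta lifts*, Selecta Math. 27 (2021) — the LLC for ALL even
orthogonal groups O(V_2n), pure inner forms included, with the local intertwining relation, transported from the book's
LLC for Sp_2n and shown equal to Arthur's in the quasi-split case; no endoscopic character relations: ⇐ the book alone;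
the sibling A10 for unitary groups was typed ⇐ Mok in tranche 46), row A11 (Chen – Zou, *Theta correspondence and Arthur
packets*, arXiv:2104.12354 — the θ-packets of their multiplicity formula A6 are independent of the dual pair and, for
quasi-split G, EQUAL Arthur's / Mok's packets with their labelings: Adams' prediction (B) in the stable range; ⇐ the book's
local AND global theorems ∧ Mok's ∧ A6 `ChenZou` ∧ B75 ∧ B2), and row B12 (H. Atobe, Math. Ann. 371 (2018) — the
Fourier – Jacobi case of the local Gan – Gross – Prasad conj. and D. Prasad's predictions (P1), (P2), stated under the printed
hypotheses (LLC) (Vogan form, Sp and SO incl. pure inner forms), (GPR), (NQ), (IS): typed as the node `AtobeFJHyp` with the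
theorems `AtobeFJ` ⇐ node, as row B3 was typed in tranche 6; the book supplies the quasi-split part of (LLC), as the paper
says, « under an assumption on the stabilization of the twisted trace formula »).  A census note rides with A9: its
Theorem 4.4 delivers Atobe – Gan's Desideratum 3.6 for O(V_2n) EXCEPT the endoscopic character identities of item (4), and
their Hypothesis 3.10 (LIR) for all pure inner forms — so row B3's node `AGevenHyp` (= 3.6 ∧ 3.10 as printed) is NOT
supplied and no supply edge is typed.  Exact supports → `DownstreamSupport7.lean` §59 (NEW support file).  Bib keys
ChenZou2021LLCEvenOrth, ChenZou2021ThetaPackets, Atobe2018FJ added by this unit; ChenZou2025AMF (A6), ChenZou2021LLCUnitary (A10), Mok2012 exist.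

**v3: the metaplectic line, II — the theta-theoretic LLC for Mp_2n and its intertwining relation (fifty-seventh tranche, unit
`pub-arthur-down-g29`).**  Tranche 11 (`Downstream2.lean`) typed the metaplectic line through ENDOSCOPY (B11: W.-W. Li's
spectral transfer, Luo's character identities; C28: W.-W. Li's Arthur packets, 2024) and tranche 1 the Shimura – Waldspurger
correspondence of Gan – Ichino (C1).  Underneath all of them lies the THETA-theoretic local Langlands correspondence for Mp_2n
of Gan – Savin (Compositio Math. 148 (2012); so far absorbed as « Arthur-free » in tranches 5, 11, 54, 56), which is Arthur-free
as a BIJECTION Irr(Mp(W)) ↔ Irr(SO(V⁺)) ⊔ Irr(SO(V⁻)) (their Theorem 1.1) but CONSUMES « the local Langlands correspondence for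
SO(V ±) » the moment it is read as an LLC (their Corollary 1.2: « Assume the local Langlands correspondence for SO(V ± ) ») — for the
split SO(V⁺) = SO_2n+1 that is the book's Theorem 1.5.1 (expected in 2012 « by combining the results of the recently released book
[Art11] by Arthur and the results of Jiang and Soudry »), for the non-split inner form SO(V⁻) it is the book's never-written Chapter 9,
supplied in print only later (Mœglin – Renard 2018 = row A8-p; Ishimoto 2024 = row A5 for generic parameters).  Typed here: NEW
row B112 (Gan – Savin: Cor. 1.2 `GanSavinLLCMp` ⇐ the node `LLCoddSO`; Thm 1.5 = Thm 12.1 `GanSavinPsi`, the variation of L_ψ in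
ψ, ⇐ book ∧ `LLCoddSO` ∧ the node `GSHypBC` = their Hypothesis LLC (b), (c)), row B8 (H. Ishimoto, Compositio Math. 156 (2020):
the local intertwining relation for Mp_2n `IshimotoLIRMp` ⇐ book ∧ `LLCoddSO` ∧ the node `LIRoddSO` (his Hypothesis 5.2, the LIR
for SO(V), « already been proven in the case V=V^+ by Arthur ») ∧ B112), row B57 (W.-W. Li, Frontiers of Math. 2026: Gan – Savin's
Theorem 1.5 for bounded parameters re-proved through Luo's endoscopic character relations `LiPsiVariation` ⇐ book ∧ B11 `LuoECR`
∧ B112 — WITHOUT the node `GSHypBC`), and two SUPPLY EDGES typed from printed supplier sentences: Ishimoto 2020 §5 (« The local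
Langlands correspondence for odd special orthogonal groups was established by Arthur [art13] and Mœglin-Renard [mr]. » ⇒ `LLCoddSO`
⇐ book ∧ A8-p `Consumers13.MRpadicOrth`) and Ishimoto 2024 = row A5 §1 (« LLC and LIR for the metaplectic groups will hold true » ⇒
`LLCoddSO` ∧ `LIRoddSO` ⇐ book ∧ `Consumers.IshimotoGeneric`).  THE POINT FOR THE CENSUS (kernel, `DownstreamSupport7.lean` §60):
with the suppliers of 2018 / 2024 every statement of the tranche is a BOOK statement — support = all 24 leaves of the book's DAG, no
Mok / KMSW leaf — and Gan – Savin's Theorem 1.5 rests in addition on the unsupplied node `GSHypBC`, which W.-W. Li's 2026 route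
avoids; Gan – Savin print their hypothesis (« Assume … »), Ishimoto 2020 prints his (abstract: « assuming the local intertwining
relation for non-quasi-split odd special orthogonal groups »), W.-W. Li prints none (« the LLC for special odd orthogonal groups is
known by [Ar13] » — for BOTH forms SO(V ±): a flag, the book treats quasi-split groups).  Bib keys GanSavin2012MetaplecticI,
Ishimoto2020LIRMp, LiWenWei2026Variation added by this unit; Ishimoto2024 (A5), MoeglinRenard2018 (A8-p), Luo2020Metaplectic (B11),
GanIchino2018 (C1), Arthur2013 exist.

**v4: the metaplectic line, III — global consumers, and one new book row (fifty-eighth tranche, same unit).**  Gan – Ichino's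
Shimura – Waldspurger theorems (row C1, Ann. of Math. 2018: `Consumers.GanIchino11` / `GanIchino14`; row C2, IMRN 2021, the full
discrete spectrum of Mp_4: `Consumers5.GanIchinoMp4` ⇐ book ∧ C1) have their own consumers, graded in the census long ago and never
typed: row C77 (C. Wu, *Periods and (χ,b)-factors of cuspidal automorphic forms of metaplectic groups*, J. Number Theory 241
(2022) — constraints on the (χ,b)-factors of the global A-parameter φ_ψ(σ) of a genuine cuspidal σ of Mp_2n(𝔸) in terms of its
lowest occurrence in theta towers and of poles of Eisenstein series; the A-parameter IS Gan – Ichino's Theorem 1.1: ⇐ C1 only,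
SECOND ORDER; the paper prints the Mœglin – Waldspurger stabilisation sentence for [MR3135650] / [Mok] / [KMSW]), rows C39 / C121
(H. Ishimoto, *Proofs of Ibukiyama's conj.s on Siegel modular forms of half-integral weight and of degree 2* (title word abbreviated), Math. Ann. 383
(2022), and *Ibukiyama correspondences … generating large discrete series*, arXiv:2312.06921 (2023) — linear isomorphisms between
spaces of vector-valued Siegel modular forms of degree 2 of half-integral and of integral weight (resp. automorphic forms on
Mp_4(𝔸_ℚ) / SO_5(𝔸_ℚ) with large discrete series at ∞) preserving L-functions, proved from Arthur's multiplicity formula for the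
split SO_5 (the book's Theorem 1.5.2) AND Gan – Ichino's for Mp_4 (C2): ⇐ book ∧ C2, the 2023 paper ⇐ book ∧ C2 ∧ C39), and the
NEW census row C201 handed over by the upstream seat up-g46 (zbMATH citation-index sweep G-UP-506), CONFIRMED under that id
(W. T. Gan – B. P. J. Wang, *Generalised Whittaker models as instances of relative Langlands duality II*, Adv. Math. 494 (2026)
110933 — Theorem 6.1, the factorisation of the generalised Whittaker period of the global theta lift Θ(Σ) on the split O_2k for a
globally generic cuspidal Σ of Sp_2a, printed conditional on Lapid – Mao's Whittaker-period conj. [LM] and a local multiplicity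
one; the book enters once, « by multiplicity one for G′ = Sp_2a (at least for tempered A-packets, since Σ is globally generic)
[Ar] » = Theorem 1.5.2: ⇐ book, no Mok / KMSW; no sentence on [Ar]'s status).  THE POINT FOR THE CENSUS (kernel,
`DownstreamSupport7.lean` §61): all four statements are BOOK statements — support = all 24 leaves of the book's DAG (C77
through C1; C39 / C121 through the SO_5 multiplicity formula AND through C2 → C1), no Mok / KMSW leaf — although C77's
framing sentence names [Mok] and [KMSW]; conditionality wording: C77 EXPLICIT (the stabilisation « has been established by a
series of works by Mœglin and Waldspurger »: the L12 pattern, grade G-ii), C39 / C121 / C201 NONE (G-i).  Bib keys Wu2022MpChiB,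
Ishimoto2022Ibukiyama, Ishimoto2023IbukiyamaDS, GanWang2026WhittakerII added by this unit; GanIchino2018 (C1), GanIchino2020 (C2),
Arthur2013 exist.
-/

set_option autoImplicit false

namespace Literature.NumberTheory.Automorphic.Arthur2013

namespace Downstream

/-! ## Fifty-fifth tranche (v1, unit `pub-arthur-down-g28`): COUNTING THE PACKETS — B91 `HLLenhancedShahidi`, the node `HLLtheta`,
B22 `HKTfixedTempered`, B63 `HKTbeyondAdams`

Context (`DOWNSTREAM.md` rows B22 l.253 `[g3]`, B63 l.537 `[g6]`, B91 l.765 `[g14b]`; typed premises reused: `Consumers2.XuMoeglinParam`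
(B2), `Consumers5.AtobeApackets` (B5), `Consumers26.HLL` (B101), `Consumers33.AtobeWhichPackets` (Atobe, Crelle 804 (2023)),
`Consumers45.MoeglinMult1` (B75), `Consumers47.MoeglinDiscretePackets` / `MoeglinPacketsComb` (B71, B72), `Consumers48.MoeglinComparaison`
(B74), `Consumers54.MoeglinImage` (C168), `MoeglinAdams` (B110), `LLCdesSpO` / `AtobeGanThetaSpO` (row B7's instances), `BakicHanzerAdams`
(B93), `HazeltineAdams` (B92); `DOWNSTREAM2.md` block `[g28b]` (this tranche); texts staged with sha256 under
`HOME/pub-arthur-down-g28/primaries/` (`paper:arxiv-2404.05773` arXiv PDF text v3, 28 pp. (B91); `paper:arxiv-2602.13090` corpus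
TeX, 43 chunks (B22); `paper:arxiv-2607.23885` arXiv PDF text, 61 pp. (B63))).  Loci: B91 p0002:L32-56, p0003:L4-22, L38-39,
p0004:L5-6, L39-40, p0009:L22-25, L53-54, L63-67, p0010:L2-3, L35, p0011:L10-12, p0013:L25-26, p0014:L2-3, L36-37, p0016:L41-44,
p0017:L25, p0018:L17-20, p0019:L2-3, p0021:L10-11, L37-39, p0022:L34-36, p0023:L33, p0024:L4-6, L14-18, p0025:L4-5, p0026–p0028;
B22 p0003:L3-25, p0005:L5, L45-62, p0006:L141, p0007:L2-15, p0009:L17-53, p0010:L2-5, p0011:L49-82, p0012:L4, p0013:L65, p0043;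
B63 p0002:L24-52, p0003:L6-60, p0004:L14-44, p0007:L50-55, p0008:L12, L33-46, p0010:L26-53, p0014:L27-49, p0015:L3-43,
p0016:L12-50, p0019:L27, L44-47, p0020:L42-44, p0023:L59-62, p0025:L19-36, p0060–p0061. -/

/-- Rows B91, B22, B63 of the census and one hypothesis node (the unpublished sequel of row B101), as an arbitrary assignment of propositions; nothing about the content of a field is assumed. [cite: Arthur2013, downstream register of the cell, fifty-fifth tranche (structure only)] -/
structure Consumers55 where
  /-- B91 (census grade G-i; PREPRINT, arXiv v3 of 18 Jun 2024): A. Hazeltine – B. Liu – C.-H. Lo, *On the enhanced Shahidi conj. and global applications* (title word abbreviated; exact title in the line comment below), arXiv:2404.05773 (`paper:arxiv-2404.05773`, arXiv PDF text, 28 pp.; p0004:L39 "Set Gn to be" p0004:L40 "the split group SO 2n+1(F ) or Sp 2n(F )." F non-archimedean of characteristic 0) — THEOREM 1.2 = THEOREMS 4.6 / 4.7 (the enhanced Shahidi conj. for G_n; statement of Thm 1.2 in the line comment): p0016:L41-42 "Theorem 4.6. LetGn be a symplectic or split odd special orthogonal group. (i) Suppose σ ∈ Πψ for some ψ ∈ Ψ(Gn).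 Then σ is generic only if σ is tempered. Hence, combining" […] p0016:L44 "(ii) Any tempered generic representation lives in exactly o ne local Arthur packet." / p0018:L17-18 "Theorem 4.7. LetGn be a symplectic or split odd special orthogonal group. (i) Suppose σ ∈ Πψ for some ψ ∈ Ψ +(Gn). Then σ is generic only if ψ is generic. Hence," […] p0018:L20 "(ii) Suppose that π is generic and π ∈ Πψ for some ψ ∈ Ψ +(Gn). Then Ψ(π) = {ψ}."; THEOREM 5.4 (the unramified representations of Arthur type classified by their L-data: p0021:L10-11 "Theorem 5.4. Supposeπ is an irreducible representation of Gn of good parity, written as π =L(∆ ρ1[x1,y 1],..., ∆ ρf [xf,yf ];π(φ,ε ))," […]) with PROPOSITION 5.5 (p0022:L35-36 "1.7(i) holds for Gn. That is, if π is unramiﬁed of Arthur type, then Ψ(π) = {ψ} is a singleton, π ∈ Πφψ , and ψ is anti-generic.") and Corollary 5.7; the GLOBAL consequences of §6: PROPOSITION 1.3 = 6.2 p0003:L4-10 "Proposition 1.3 (Proposition 6.2). Suppose that π = ⊗πv lies in a global Arthur packet Πψ of Gn(Ak) and that there exists a ﬁnite place v0 such that πv0 is generic. Then the following holds: (1) The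 global Arthur parameter is of the form ψ = ⊞m i=1µi ⊗S1, whereµi’s are irreducible cuspidal representations of general linear groups. (2) For any place v, ψv is generic. In particular, πv is generic for almost all ﬁnite places v.", COROLLARY 1.8 p0004:L5-6 "Corollary 1.8. Let π = ⊗vπv be an automorphic representation of Gn(Ak) in the discrete spectrum with global Arthur parameter ψ ∈ Ψ(G n(k)). Then, for almost all ﬁnite places v, we have πv ∈ Πφψv.", Corollary 6.1, and — under the Ramanujan hypothesis for GL_n (their Conj. 6.4) — Propositions 1.5 = 6.7 and 6.6 (Clozel's expectations for G_n). [cite: HazeltineLiuLo2024Shahidi, Thm 1.2 = Thms 4.6 (p0016:L41-44), 4.7 (p0018:L17-20); Thm 5.4 (p0021:L10-11), Prop. 5.5 (p0022:L34-36); Prop. 1.3 (p0003:L4-12), Cor. 1.8 (p0004:L5-6), Prop. 1.5 (p0003:L20-22); scope p0004:L39-40] -/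
  HLLenhancedShahidi : Prop
  /-- HYPOTHESIS NODE — THE UNPUBLISHED SEQUEL OF ROW B101: A. Hazeltine – B. Liu – C.-H. Lo, *On the intersection of local Arthur packets under the theta correspondence*, « 2026, preprint » — the [HLL25] of B22 and the [23] of B63 (bibliography entries in the line comments), NOT on arXiv and not otherwise public in 2026-08; no text is held, so no premise is typed for it and no supplier edge exists in the register.  WHAT THE CONSUMERS TAKE FROM IT: the parametrisation π(E) of the packets of the quasi-split EVEN ORTHOGONAL groups O^±_2m by extended multi-segments and its non-vanishing and intersection theory (B22: p0006:L141 "Let $\EE\in\Eseg(G_n).$ We attach a representation $\pi(\EE)$ of $G_n$ via [HLL25] which is an adaptation of [HJLLZ24]." p0007:L2 "We remark that [HLL25] agrees with that of Atobe given in [Ato20b] for split symplectic and odd special orthogonal groups. The advantage of [HLL25] over [Ato20b] is that it only assumes the local Langlands correspondence and hence applies more broadly than [Ato20b] which assumes a theory of derivatives as in [AM23]. In particular, [HLL25] is well-defined for quasi-split even orthogonal groups." […] p0007:L13 "For split symplectic and odd special orthogonal groups, the above theorem was first proven by Atobe ( [Ato20b]) using the construction of $\pi(\EE)$ from [Ato20b].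 Then [HJLLZ24] provided another way to compute the representation $\pi(\EE)$ given in [Ato20b] which only uses the local Langlands correspondence. Finally, in [HLL25], the above theorem was proven for quasi-split even orthogonal groups (assuming a local Langlands correspondence as in [AG17b])." […] p0009:L20 "We now state the non-vanishing theorem which was proven for $G_n=\Sp_{2n}(F)$ in [Ato20b] and for $G_n=\OO_{2n}^\pm(F)$ in [HLL25]."; B63: p0010:L26-30 "LetE ∈Eseg(G).IfG= Sp 2n(F),then we attach a representationπ(E) ofGas in [3, §3.2]. This is done using the theory of derivatives developed by Atobe and M ´ ınguez in [7]. We have that eitherπ(E) vanishes orπ(E)∈Π(G).IfG= O ± 2m(F),then we attach a representationπ(E) ofGas in [23, Definition 6.3]. This definition avoids the use" [continued in the line comment: the definition uses Adams' prediction as established by Mœglin] […] p0010:L49 "WhenG= Sp 2n(F),the above theorem was proven by Atobe ([3, Theorem 3.3])." / p0010:L51 "2m(F), the above theorem was proven in [23, Theorem 6.10]. As a" […] p0010:L53 "multiplicity-free ([33]), we obtain the following corollary." […]), the reformulation of the Adams-line results in that language (B63: p0015:L11-12 "ets ([8, 18, 31]); however, these results are reinterpreted using extended multi-segments in [23]. We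 recall this reformulation here." p0015:L37 "Theorem 3.19([23, Proposition 6.2]).LetE ∈Eseg(G n).Ifπ=π(E)̸= 0andα≫0" […] p0015:L43 "the calculation is done algorithmically. This is a reformulation of a construction of [8]." […] p0016:L12-13 "This algorithm computes the theta lift if it is nonzero. From [23, Theorem 7.5], we directly obtain the following reformulation of [8, Theorem A].") and the count after theta for α ≫ 0 (B63: p0003:L29-31 "consequence of the theory of intersections of local Arthur packets developed by Liu, Lo, and the first author ([22, 23], see Theorem 3.15) that Ψ(θ± −α(π)) ={ψ α |ψ∈Ψ(π)}"). [cite: HazeltineKumarTung2026Fixed, §2.2 (p0006:L141, p0007:L2-13, p0009:L17-20), bibliography [HLL25] (p0043:L25); HazeltineKumarTung2026Beyond, §3 (p0010:L26-53, p0015:L11-43, p0016:L12-13), p0003:L29-31, bibliography [23] (p0061:L26-27) (node; no supplier)] -/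
  HLLtheta : Prop
  /-- B22 (census grade G-i; PREPRINT 2026): A. Hazeltine – A. Kumar – A. Tung, *On Arthur packets containing a fixed tempered representation*, arXiv:2602.13090 (`paper:arxiv-2602.13090`, corpus TeX, 43 chunks; p0003:L3 "Let $F$ be a $p$-adic field. For simplicity, we let $G_n$ denote the split group $\Sp_{2n}(F)$ throughout this introduction. We remark that our results hold for pure inner forms of quasi-split orthogonal or symplectic groups, but extra assumptions may be required to pass from the representation theory to the combinatorial arguments in certain cases (see Remark (rmk Arthur packet obstruction))." §2: p0005:L5 "We let $\mathrm{G}_n=\Sp_{2n},$ $ \SO_{2n+1},$ or $\OO_{2n}$ and assume that $G_n^+=\mathrm{G}_n(F)$ is quasi-split. When $G_n^+$ is a quasi-split non-split even orthogonal group, we remark that $G_n^+$ has a quasi-split non-split pure inner form which we denote by $G_n^-.$ For brevity, we let $G_n\in\{G_n^\pm\}.$ We set $\epsilon_{G_n}=-1$ if $G_n=G_n^-$ and $\epsilon_{G_n^+}=1$, otherwise." […] p0005:L5 "We expect our results to apply more generally than groups considered above. Specifically, we expect analogous results for pure inner forms of quasi-split symplectic, odd special orthogonal, or even orthogonal groups;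 however, the necessary preliminary results on local Arthur packets have not been established in the necessary generality (see Remark (rmk Arthur packet obstruction)).") — THEOREM 1.2 p0003:L15-16 "Theorem 1.2 (Theorem (thm-count-temp)). For certain irreducible tempered representations $\pi$, there is a recursive formula for determining the number of local Arthur packets which contain $\pi$." = THEOREM 3.7 p0011:L74-77 "Theorem 3.7 (count for tempered representations). Let $\EE\in\VRep_\rho^\mathbb{Z}(G_n)$ be tempered. Suppose that $\EE$ decomposes into blocks $\mathcal{B}_1, \dots, \mathcal{B}_k$ in that order. Then \[|\Psi(\pi(\EE))| = |\Psi(\pi(\BB_1))| \cdot \prod_{i=2}^k |\Psi(\pi(sh^1(\BB_i)))|.\]" (p0011:L82 "Note that we can compute $|\Psi(\pi(\BB_1))|$ and $|\Psi(\pi(sh^1(\BB_i)))|$ using Theorem (thm-count-block-temp), so the above theorems together give a complete computation of $|\Psi(\pi(\EE))|$ for any tempered $\EE\in\VRep_\rho^\mathbb{Z}(G_n)$.") with THEOREM 3.6 p0011:L49 "Theorem 3.6 (count for blocks)." p0011:L51 "Let $\mathcal{B}$ be a block and define" [B′ := rc_{c_max}(B), B″ := rc_{c_max−1}(B′); |Ψ(π(B))|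 by recursion on these]; proved as Theorems 6.10 / 7.14; the integer-supported case of their Problem 1.1 (the half-integer case left open, Remark 1.3). [cite: HazeltineKumarTung2026Fixed, Thm 1.2 (p0003:L15-16) = Thm 3.7 (p0011:L74-77), Thm 3.6 (p0011:L49-56), Remark 3.8 (p0011:L82); setting p0003:L3, p0005:L5] -/
  HKTfixedTempered : Prop
  /-- B63 (census grade G-i; PREPRINT 2026): A. Hazeltine – A. Kumar – A. Tung, *Beyond the Adams conj.* (title word abbreviated; exact title in the line comment below), arXiv:2607.23885 (`paper:arxiv-2607.23885`, arXiv PDF text, 61 pp.; p0002:L24 "Hereinafter, letm, n∈Z ≥0 andG n = Sp 2n(F) denote a split symplectic group" p0002:L26-28 "m = O ± 2m(F) denote an even orthogonal group (see§2.1 for an explanation of the notation). We assume thatm > nand letα= 2m−2n−1 denote the" […] F non-archimedean of characteristic 0; the theta lifts θ^±_{−α} : Π(G_n) → Π(H^±_m) ∪ {0} on the two towers of even orthogonal groups, θ^up the going-up tower) — THEOREM 1.4 = 4.11 p0003:L57-59 "Theorem 1.4(Theorem 4.11).In six cases, we determine a recursive formula for |Ψ(θup −mup,α(π)(π))|." (p0019:L44-47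 "Theorem 4.11.LetE= ([A i, Bi], li, ηi)∈VRep ρ(Gn)be a tempered extended multi- segment. LetB 1, . . . ,Bk denote the block decomposition ofE. We consider various cases determined by the columns near the end of the first block. LetH col be the last column ofB 1 and letN col be the first column ofB 2." […]; the seventh case is their Conj. 4.12, line comment); THEOREM 1.5 p0004:L14-21 "Theorem 1.5.Letπ∈Π(G n)be of Arthur type. (1) Ifπis anti-tempered, then|Ψ(θ up −mup,α(π)(π))|is determined via a recursive formula (Theorem 4.17). (2) Ifπis generic, then|Ψ(θ up −mup,α(π)(π))| ∈ {1,2,3}(Theorem 4.18). (3) Ifπis unramified, then|Ψ(θ up −mup,α(π)(π))| ∈ {2,3}(Theorem 4.20)." (Thm 4.17: p0023:L59-62 "Theorem 4.17.SupposeEis an anti-tempered extended multi-segment. Denote its first row by([n,−n], n, η(E))and letm n be the multiplicity of thenth column ofdual(E). Then|Ψ(θ up −mup,α(π(E)))|is equal to:" […]); THEOREM 1.7 = row B22's Theorem 3.7 restated (p0019:L27 "Theorem 4.8([20, Theorem 3.7]).LetE ∈VRep ρ(G)be a tempered extended multi-" […]); Appendices A–B (commutation of the operators with Θ_i). [cite: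 HazeltineKumarTung2026Beyond, Thm 1.4 (p0003:L57-59) = Thm 4.11 (p0019:L44-47), Thm 1.5 (p0004:L14-21) = Thms 4.17 (p0023:L59-62), 4.18, 4.20, Thm 1.7 (p0004:L43-44) = Thm 4.8 (p0019:L27); setting p0002:L24-36] -/
  HKTbeyondAdams : Prop

variable (ν : Nodes) (μ : Mok2015.Nodes) (κ : KMSW2014.Nodes) (c₂ : Consumers2) (c₅ : Consumers5) (c₁₁ : Consumers11)
  (c₁₃ : Consumers13) (c₁₄ : Consumers14) (c₂₆ : Consumers26) (c₃₃ : Consumers33) (c₄₃ : Consumers43) (c₄₄ : Consumers44)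
  (c₄₅ : Consumers45) (c₄₇ : Consumers47) (c₄₈ : Consumers48) (c₅₁ : Consumers51) (c₅₄ : Consumers54) (c₅₅ : Consumers55)

-- Verbatim, the sentences and titles the docstring lint keeps out of docstrings (each names a conj. or an open question) and the bibliography entries.
-- B91 (`paper:arxiv-2404.05773`), title p0001:L2 « ON THE ENHANCED SHAHIDI CONJECTURE AND GLOBAL APPLICA TIONS »: p0002:L32-33 "πv ∈ Πψv . In [ Art13], Arthur proved these global conjectures and the existence of local Arthur packets for symplectic and quasi-split special orthogonal groups." / §1.2: p0002:L47-53 "In [LS22], the second-named author and Shahidi proved Conjecture 1.1 for symplectic and quasi-split special orthogonal groups, applying the matching method of endoscopic liftings, assuming properties of the wavefront sets of certain bitorsor representations. Let Gn be the symplectic or the split odd special orthogonal group o f rank n and let Gn = Gn(kv). As an application of the authors’ results on the intersectio n theory of local Arthur packets in [ HLL22] and the classiﬁcation of generic representations as in [ Mui98, JS04, Liu11], we prove Conjecture 1.1 for Gn, without any assumptions." / Thm 1.2: p0002:L54 "Theorem 1.2 (Theorems 4.6 and 4.7). Conjecture 1.1 is valid for Gn." / Prop. 1.5: p0003:L20-22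 "Proposition 1.5 (Proposition 6.7). Assume the Ramanujan conjecture for GLn. Suppose that π = ⊗πv lies in a global Arthur packet Πψ of Gn(Ak) and that there exists a ﬁnite place v0 such that πv0 is generic. Then πv is tempered for all places v." / Prop. 5.5 (first line): p0022:L34 "Proposition 5.5. Conjecture" / Conj. 1.7 and [Mœ09b]: p0003:L38-39 "dual version of the enhanced Shahidi conjecture is expected by experts. For quasi-split classical groups, this is a consequence of [ Mœ09b , Proposition 6.4]."
-- B91 bibliography: p0026:L57-57 "[Art13] J. Arthur, The endoscopic classiﬁcation of represe ntations: Orthogonal and Symplectic groups. Colloquium" / p0027:L4 "[HLL22] A. Hazeltine, B. Liu, C.-H. Lo, On the intersection o f local Arthur packets for classical groups and application s." / p0027:L31 "[Mœ06a] C. Mœglin, Paquets d’Arthur pour les groupes classi ques; point de vue combinatoire. (2006)." / p0027:L33 "[Mœ09a] C. Mœglin, Paquets d’Arthur discrets pour un groupe classique p-adique. Automorphic forms and L-functions II." / p0027:L36 "[Mœ09b] C. Mœglin, Comparaison des paramtres de Langlands e t des exposants l’intrieur d’un paquet d’Arthur. J. Lie" / p0027:L38 "[Mœ11a] C. Mœglin,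 Multiplicit´ e1 dans les paquets d’Arthur aux places p-adiques. On certain L-functions, 333-374, Clay" / p0027:L40 "[Mœ11b] C. Mœglin, Image des op´ erateurs d’entrelacements normalis´ es et pˆ oles des s´ eries d’Eisenstein.Adv. Math. 228" / p0028:L8 "[Xu17a] B. Xu, On the cuspidal support of discrete series for p-adic quasisplit Sp(N) and SO(N). Manuscripta Math. 154," / p0028:L10 "[Xu17b] B. Xu, On Mglin’s parametrization of Arthur packets for p-adic quasisplit Sp(N) and SO(N). Canad. J. Math."
-- B22 (`paper:arxiv-2602.13090`), Remark 2.21 (end): p0010:L5 "A crucial roadblock in extending the theory is that determining the existence of local Arthur packets for non-quasi-split groups currently remains an open problem."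
-- B22 bibliography: p0043:L3 "[Art13] James Arthur, \emph{The endoscopic classification of representations}, American Mathematical Society Colloquium Publications, vol.~61, American Mathematical Society, Providence, RI, 2013, Orthogonal and symplectic groups." / p0043:L5 "[Ato20b] Hiraku Atobe, \emph{Construction of local {$A$}-packets}, J. Reine Angew. Math. \textbf{790} (2022), 1--51." / p0043:L7 "[Ato23] \bysame, \emph{The set of local {A}-packets containing a given representation}, J. Reine Angew. Math. \textbf{804} (2023), 263--286." / p0043:L9 "[AG17b] Hiraku Atobe and Wee~Teck Gan, \emph{On the local {L}anglands correspondence and {A}rthur conjecture for even orthogonal groups}, Represent. Theory \textbf{21} (2017), 354--415." / p0043:L11 "[AGIKMS24] Hiraku Atobe, Wee~Teck Gan, Atsushi Ichino, Tasho Kaletha, Alberto MÃ­nguez, and Sug~Woo Shin, \emph{Local intertwining relations and co-tempered $a$-packets of classical groups}, 2024, arXiv:2410.13504." / p0043:L19 "[HJLLZ24] Alexander Hazeltine, Dihua Jiang, Baiying Liu, Chi-Heng Lo, and Qing Zhang, \emph{{Arthur representations and unitary dual for classical groups}}, 2024, arXiv:2410.11806v3." / p0043:L21 "[HKT] Alexander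 Hazeltine, Aarya Kumar, and Andrew Tung, \emph{{Beyond the {A}dams conjecture}}, preprint." / p0043:L23 "[HLL22] Alexander Hazeltine, Baiying Liu, and Chi-Heng Lo, \emph{On the intersection of local {A}rthur packets for classical groups and applications}, 2024, arXiv:2201.10539v3." / p0043:L25 "[HLL25] \bysame, \emph{On the intersection of local {A}rthur packets under the theta correspondence}, 2026, preprint." / p0043:L33 "[Moe11b] \bysame, \emph{Image des op\'{e}rateurs d'entrelacements normalis\'{e}s et p\^{o}les des s\'{e}ries d'{E}isenstein}, Adv. Math. \textbf{228} (2011), no.~2, 1068--1134." / p0043:L35 "[Moe11a] \bysame, \emph{Multiplicit\'{e} 1 dans les paquets d'{A}rthur aux places {$p$}-adiques}, On certain {$L$}-functions, Clay Math. Proc., vol.~13, Amer. Math. Soc., Providence, RI, 2011, pp.~333--374."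
-- B63 (`paper:arxiv-2607.23885`), title p0001:L1 « BEYOND THE ADAMS CONJECTURE »: p0003:L6-11 "We remark that the Adams conjecture in this setting is fully understood via [8, 31]. In particular, Mœglin showed that the Adams conjecture is true whenα≫0 ([31, Theorem 6.1]) but it can and does fail otherwise. The exact extent of this failure is determined by Baki´ c and Hanzer algorithmically ([8, Theorem A]). Moreover, if we fix πand allowψto vary, then we understand the extent to which the Adams conjecture holds via [18, Theorem 1.3]." / Conj. 1.3: p0003:L51-53 "Conjecture 1.3(Theorem 4.11 and Conjecture 4.12).Suppose thatπ∈Π(G n)is tempered. Then there is a recursive formula for computing|Ψ(θ up −mup,α(π)(π))|." / p0003:L60 "The remaining case for Conjecture 1.3 is stated in Conjecture 4.12." / the strategy paragraph (THE PREMISE LIST of `E_HKTbeyondAdams`): p0004:L25-31 "We now remark on the strategy of the proof of Theorem 1.4. The main idea is to reduce to a combinatorial problem using several deep results: the parameterization of local Arthur packets by extended multi-segments and their theory of intersections developed in [3, 22, 23], the validity of the Adams conjecture for the going-up tower ([8, 31]), the calculation of the first occurrence on the going-up tower for tempered representations ([6]), and the translation of these results into the language of extended multi-segments ([23]). The resulting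 combinatorial problem then largely follows from" / §2.4: p0008:L33 "Mœglin verified that whenαis large, the Adams conjecture is true." / p0008:L37-40 "However, Mœglin also showed that the Adams conjecture can and does fail in general. The failure of the Adams conjecture in this case is well-understood through the works of [8, 18]. We are particularly concerned with the case of the going-up tower forπin which case Baki´ c and Hanzer showed that the Adams conjecture always holds." / §3 (π(E) for O_2m): p0010:L31-32 "of derivatives by using the Adams conjecture as established by Mœglin (see Theorem 2.8). Again, we have that eitherπ(E) vanishes orπ(E)∈Π(G)." / Conj. 4.12: p0020:L42-44 "Conjecture 4.12.LetE= ([A i, Bi], li, ηi)∈VRep ρ(Gn)be a tempered extended multi- segment. Suppose further thatEstarts at zero and consider the (ordered) decomposition ofEinto blocksB 1, . . . ,Bk."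
-- B63 bibliography: p0060:L33-35 "2. James Arthur,The endoscopic classification of representations, American Mathematical Society Colloquium Publications, vol. 61, American Mathematical Society, Providence, RI, 2013, Orthog- onal and symplectic groups. 2, 7, 16" / p0060:L36-37 "3. Hiraku Atobe,Construction of localA-packets, J. Reine Angew. Math.790(2022), 1–51. 4, 9, 10, 12, 14, 15, 17, 33" / p0060:L38-39 "4. ,The set of local A-packets containing a given representation, J. Reine Angew. Math.804 (2023), 263–286. 3" / p0060:L40-41 "5. Hiraku Atobe and Wee Teck Gan,Local theta correspondence of tempered representations and Langlands parameters, Invent. Math.210(2017), no. 2, 341–415. 4, 16" / p0060:L42-43 "6. ,On the local Langlands correspondence and Arthur conjecture for even orthogonal groups, Represent. Theory21(2017), 354–415. 4" / p0060:L46-47 "8. Petar Baki´ c and Marcela Hanzer,Theta correspondence and Arthur packets: on the Adams con- jecture, 2022, arXiv 2211.08596. 3, 4, 8, 15, 16, 32" / p0061:L15-16 "18. Alexander Hazeltine,The Adams conjecture and intersections of local Arthur packets, arXiv:2403.17867. 3, 8, 15" / p0061:L17-19 "19. Alexander Hazeltine, Aarya Kumar, and Andrew Tung,Beyond the Adams conjecture,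 2025, REU Report, available athttps://lsa.umich.edu/content/dam/math-assets/reu-su22/2025/ Hazeltine,%20Alex.pdf. 56" / p0061:L20-21 "20. ,On Arthur packets containing a fixed tempered representation, 2026, arXiv:2602.13090. 4, 17, 18, 19, 21, 25, 26, 27, 28, 29, 30, 31, 32, 33, 35, 36, 37, 38, 39, 40, 41, 42, 43, 44, 48, 49, 50" / p0061:L22-23 "21. Alexander Hazeltine, Baiying Liu, and Chi-Heng Lo,On the enhanced Shahidi conjecture and global applications, 2024, arXiv:2404.05773. 4, 25" / p0061:L24-25 "22. ,On the intersection of local Arthur packets for classical groups and applications, 2024, arXiv:2201.10539v3. 3, 4, 8, 11, 14" / p0061:L26-27 "23. ,On the intersection of local Arthur packets under the theta correspondence, 2026, preprint. 3, 4, 8, 10, 11, 14, 15, 16, 33" / p0061:L36-37 "28. Colette Mœglin,Sur certains paquets d’Arthur et involution d’Aubert-Schneider-Stuhler g´ en´ eralis´ ee, Represent. Theory10(2006), 86–129. 3" / p0061:L38-39 "29. ,Comparaison des param` etres de Langlands et des exposants ` a l’int´ erieur d’un paquet d’Arthur, J. Lie Theory19(2009), no. 4, 797–840. 4, 25" / p0061:L40-42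 "30. ,Paquets d’Arthur discrets pour un groupe classiquep-adique, Automorphic forms andL- functions II. Local aspects, Contemp. Math., vol. 489, Amer. Math. Soc., Providence, RI, 2009, pp. 179–257. 3" / p0061:L43-45 "31. ,Conjecture d’Adams pour la correspondance de Howe et filtration de Kudla, Arithmetic geometry and automorphic forms, Adv. Lect. Math. (ALM), vol. 19, Int. Press, Somerville, MA, 2011, pp. 445–503. 3, 4, 8, 15" / p0061:L46-47 "32. ,Image des op´ erateurs d’entrelacements normalis´ es et pˆ oles des s´ eries d’Eisenstein, Adv. Math.228(2011), no. 2, 1068–1134. 8" / p0061:L48-49 "33. ,Multiplicit´ e 1 dans les paquets d’Arthur aux placesp-adiques, On certainL-functions, Clay Math. Proc., vol. 13, Amer. Math. Soc., Providence, RI, 2011, pp. 333–374. 7, 10"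

/-- B91 ⇐ THE BOOK (LOCAL THEOREM 1.5.1 AND GLOBAL §§1.4–1.5, THEOREM 1.5.2) ∧ B101 ∧ B5 ∧ ATOBE (Crelle 804) ∧ B75 ∧ C168 ∧ B72 ∧ B2 ∧ B71 (`paper:arxiv-2404.05773`).  THE PACKETS: §2 p0009:L22 "Art13, Theorem 1.5.1], for a local Arthur parameter ψ ∈ Ψ(Gn), Arthur constructed a ﬁnite" p0009:L23-25 "multi-set Π ψ consisting of irreducible unitary representations of Gn. We call Π ψ the local Arthur packet of ψ. Mœglin gave another construction of Π ψ and showed that it is multiplicity-free ([ Mœ11a ]). For ψ ∈ Ψ +(Gn), Arthur deﬁned the local Arthur packet Π ψ ([Art13, (1.5.1)]), by" — [Art13] ↦ the book at all ranks (`∀ N, ν.Everything N`), also Theorem 2.11 p0011:L10-12 "The following theorem is Arthur’s classiﬁcation of the temp ered representations. Theorem 2.11 ([Art13, Theorem 1.5.1]) . Any irreducible tempered representation of Gn lies in Πψ for some tempered local Arthur parameter ψ. Moreover, if ψ1 and ψ2 are two non-equivalent tempered local" […], and the GLOBAL theorems of §6: p0023:L33 "Following [ Art13, §1.4], a global Arthur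 parameter ψ" […] p0024:L4-6 "Arthur constructed global Arthur packets Π ψ in [ Art13, §1.5]. According to the construction, if π ∈ Πψ withπ = ⊗vπv, then πv ∈ Πψv for all places v. Moreover, the character associated to πv in ˆSψv" […]; p0025:L4-5 "Theorem 6.3 ([Art13, Theorem 1.5.2]) . If G is a symplectic group or quasi-split special orthogonal group, then" […]; Corollary 6.1's proof p0024:L14-18 "[Art13, Theorem 1.5.1(a)], πur v ∈ Πψv corresponds to the trivial character in ˆSψv , and hence πur v = πv since the map Π ψv → ˆSψv is a bijection (by construction of Π ψv using extended multi-segments or [Art13, Lemma 7.1.1]). This completes the proof of the corollary. □" (the sentence p0002:L32-33 naming Arthur's global theorems is in the line comment); [Mœ11a] = B75 ↦ `Consumers45.MoeglinMult1` (also p0014:L36-37 "Note that these conditions are exactly the opposite of the co nditions for π(φ,ε ) being supercuspidal (see [ Mœ11a , Theorem 2.5.1] or [ Xu17a, Theorem 3.3])."); THE REDUCTIONS: p0009:L53-54 "2 in the decomposition ( 2.2), the parabolic induction in ( 2.4) is always irreducible by [Mœ11b , Proposition 5.1] (see also [ Jan97, Theorem 9.3(6)], [ Tad09, Proposition 3.2(i)]).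 We say that" […] p0010:L2-3 "Theorem 2.8 ([ Mœ11b , Proposition 5.1]) . Let ψ ∈ Ψ +(Gn) with decomposition ψ = ψnu,>0 +ψnp +" — [Mœ11b] = C168 ↦ `Consumers54.MoeglinImage`; p0009:L63 "In [" p0009:L64-67 "Mœ06a ], Mœglin constructed the local Arthur packet Π ψu from Π ψgp , Theorem 2.7 ([ Mœ06a , Theorem 6], [ Xu17b, Proposition 8.11]) . Let ψu ∈ Ψ(Gn) with a choice of" […] — [Mœ06a] = B72 ↦ `Consumers47.MoeglinPacketsComb`, [Xu17b] = B2 ↦ `Consumers2.XuMoeglinParam` (also p0010:L35 "[Xu17b, §2] and use it to give a parametrization of the tempered spectr um of Gn." […] p0017:L25 "Therefore, [ Xu17b, Proposition 8.3] implies" […]); §5 p0019:L2 "Thus [Mœ09a , Corollary 4.2]" p0019:L3 "implies Ψ(St Gn) ⊆ {ψSt,ˆψSt}." — [Mœ09a] = B71 ↦ `Consumers47.MoeglinDiscretePackets`; THE INTERSECTION THEORY AND ATOBE: p0013:L25-26 "3.2. Intersection of local Arthur packets. In this subsection, we recall the main results in [ HLL22] and [ Ato23] on the intersection of local Arthur packets.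 We state them w ith the notation in [ HLL22]." […] p0014:L2-3 "Now we state the main theorems of [ HLL22]. Theorem 3.5 ([HLL22, Theorem 1.4]) . Let E1 and E2 be two extended multi-segments for Gn. Suppose" […] — [HLL22] = B101 ↦ `Consumers26.HLL`, [Ato23] = H. Atobe, Crelle 804 (2023) ↦ `Consumers33.AtobeWhichPackets`; p0021:L37-39 "to [ Art13, Theorem 1.5.1(a)], this unramiﬁed representation in the l ocal Arthur packet Π ψE must cor- respond to the trivial character in ˆSψ. On the other hand, [ Ato22b, Theorem 3.6] conﬁrms that π(E) is the only representation in Π ψ corresponding to the trivial character in ˆSψ. Therefore, we conclude that" — [Ato22b] (Atobe's construction, Crelle 790) = B5 ↦ `Consumers5.AtobeApackets`.  Context, not premises: [LS22] (Liu – Shahidi's proof under wavefront hypotheses: p0002:L48-49 "special orthogonal groups, applying the matching method of endoscopic liftings, assuming properties of the wavefront sets of certain bitorsor representations." […] p0002:L51 "As an application of the authors’ results on the intersectio n theory of local Arthur packets in [ HLL22]"), [HLLZ22], [Mœ09b, Prop. 6.4] = B74 (the quasi-split case of their Conj. 1.7, for which they give a new proof: line comment), the list « [Kon02, JS03, Liu11,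 JS12, MW12, Wal12, Art13, Var17] ».  Arthur-free, absorbed: [Xu17a] (cuspidal support; as in tranche 5), [AM23] / Jantzen / Tadić (derivatives, irreducibility), the classification of generic representations [Mui98, JS04, Liu11], Satake, Casselman – Shahidi.  Premises: the book (all ranks), `HLL`, `AtobeApackets`, `AtobeWhichPackets`, `MoeglinMult1`, `MoeglinImage`, `MoeglinPacketsComb`, `XuMoeglinParam`, `MoeglinDiscretePackets`. [cite: HazeltineLiuLo2024Shahidi, §2 (p0009:L22-25, L53-54, L63-67, p0010:L2-3, L35, p0011:L10-12), §3 (p0013:L25-26, p0014:L2-3, L36-37), §4 (p0017:L25), §5 (p0019:L2-3, p0021:L37-39), §6 (p0023:L33, p0024:L4-6, L14-18, p0025:L4-5); HazeltineLiuLo2022, as [HLL22]; Atobe2023WhichPackets, as [Ato23]] -/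
def E_HLLenhancedShahidi : Prop :=
  (∀ N, ν.Everything N) → c₂₆.HLL → c₅.AtobeApackets → c₃₃.AtobeWhichPackets → c₄₅.MoeglinMult1 → c₅₄.MoeglinImage →
    c₄₇.MoeglinPacketsComb → c₂.XuMoeglinParam → c₄₇.MoeglinDiscretePackets → c₅₅.HLLenhancedShahidi

/-- B22 ⇐ THE BOOK ∧ B5 ∧ ATOBE (Crelle 804) ∧ B101 ∧ THE NODE `HLLtheta` ∧ THE Sp / O DESIDERATUM ∧ C168 ∧ B75 (`paper:arxiv-2602.13090`).  THE PACKETS: p0003:L6 "Arthur proved the existence of the local Langlands correspondence for $G_n$ by establishing the existence of local Arthur packets ( [Art13])." §2.1 p0005:L45 "For a local Arthur parameter $\psi \in \Psi(G_n)$, Arthur showed the existence of a finite multi-set $\Pi_\psi$, called a local Arthur packet, consisting of irreducible unitary representations of $G_n$ that satisfy certain twisted endoscopic character identities ( [Art13]; see also [AGIKMS24]). We do not recall the precise definition of $\Pi_\psi$. Instead, it suffices for our purposes to recall a parameterization of $\Pi_\psi$ using extended multi-segments (see Theorem (thm Arthur packets extended multi-segment parameterization))." — [Art13] ↦ the book at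 all ranks (also Theorem 2.20 p0009:L48-49 "Theorem 2.20 ( [Art13]). We have that" [Π_temp(G) = ⋃_{ψ ∈ Ψ_temp(G)} Π_ψ] p0009:L53 "Moreover, if $\psi_1,\psi_2\in\Psi_{temp}(G)$ and $\psi_1\neq\psi_2$, then $\Pi_{\psi_1}\cap\Pi_{\psi_2}=\emptyset.$"); « see also [AGIKMS24] » (arXiv:2410.13504, the local intertwining relation: one of the book's own 2024 preprint LEAVES, inside `ν`, not a separate premise); p0005:L47 "Mœglin showed that the computation of $\Pi_\psi$ can be reduced to the “good parity” case (see Theorem (thm red to gp) below). We proceed by recalling this reduction." […] p0005:L62 "Theorem 2.3 ( [Moe11b])." — [Moe11b] = C168 ↦ `Consumers54.MoeglinImage`; p0007:L15 "Mœglin showed that local Arthur packets are multiplicity-free ( [Moe11a]). Consequently, we have the following corollary." — [Moe11a] = B75 ↦ `Consumers45.MoeglinMult1` (Corollary 2.8); THE PARAMETRISATION AND THE INTERSECTIONS: p0003:L18 "First, the parameterization of local Arthur packets using extended multi-segments ( [Ato20b, HLL25]; see (sec extended multi-segments)) and the theory of intersections of local Arthur packets ( [HLL22, HLL25]; see (sec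 intersections))" […] — [Ato20b] = B5 ↦ `Consumers5.AtobeApackets` (Theorem 2.7 p0007:L6-7 "Theorem 2.7. Suppose $\psi= \bigoplus_{\rho} \bigoplus_{i \in I_{\rho}} \rho \otimes S_{a_i} \otimes S_{b_i}$ is a local Arthur parameter of good parity of $G_n$ which is assumed to be quasi-split. Choose an admissible order $>$ on $I_{\rho}$ for each $\rho$ that satisfies ($P'$) if $\frac{a_i-b_i}{2}<0$ for some $i \in I_{\rho}$. Then" [⊕_{π ∈ Π_ψ} π = ⊕_E π(E)] p0007:L11 "where $\EE$ runs over all extended multi-segments with $\supp(\EE)= \supp(\psi)$ and $\pi(\EE) \neq 0$."; the non-vanishing Theorem 2.19 for Sp_2n), [HLL22] = B101 ↦ `Consumers26.HLL` (p0009:L17 "The above theorem was proven for quasi-split symplectic and odd special orthogonal groups in [HLL22] and quasi-split even orthogonal groups in [HLL25]. With the above theorem in mind, for $\EE,\EE'\in\Eseg(G_n),$ we write $\EE\sim\EE'$, and say that they are (strongly) equivalent, if $\EE$ and $\EE'$ are related by a finite composition of raising operators and their inverses."), [HLL25] ↦ the node `HLLtheta` (π(E), Theorem 2.7, Theorems 2.18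 / 2.19 for O^±_2n, the Aubert dual); [Ato23] ↦ `Consumers33.AtobeWhichPackets` (p0013:L65 "Before proving the claim, we first recall an operator, called phantom (dis)appearing, defined by Atobe ( [Ato23])."); THE LLC FOR THE EVEN ORTHOGONAL GROUPS: Theorem 2.7 for quasi-split O_2n is [HLL25]'s « (assuming a local Langlands correspondence as in [AG17b]) » (p0007:L13) — [AG17b] = Atobe – Gan, Represent. Theory 21 (2017): the desideratum for O(V_2n) ↦ `Consumers54.LLCdesSpO` (as B93's « [6, Desideratum 3.9 (9)] » in tranche 54; row B3's node `AGevenHyp` carries more — Hypothesis 3.10 for pure inner forms — and is not used).  Context, not premises: [HJLLZ24] = row B100 `Consumers26.HJLLZ` (« an adaptation of », « another way to compute π(E) »: the construction used is [HLL25]'s), [Moe06b] / [Moe09a] / [GGP20] (the known supercuspidal case: p0003:L11 "For example, a known case is when $\pi$ is supercuspidal. In this situation, work of Mœglin implies that $\pi$ lies in as many local Arthur packets as possible ( [Moe06b,Moe09a]; see also [GGP20])."), [HKT] = row B63 (the announced application: p0003:L25 "Indeed, in a forthcoming article ( [HKT]), we will use Theorem (thm tempered count intro) to study the number of Arthur packets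 containing the theta lift to the first occurrence of going-up tower of an irreducible tempered (or anti-tempered) representation of $G_n$.").  The scope caveat for pure inner forms (Remark 2.21: p0010:L2-3 "The parameterization of local Arthur packets using extended multi-segments and corresponding theory of intersections is expected more generally. Fixing a quasi-split form $G_n^+$ of a symplectic, odd special orthogonal group, or even orthogonal group, we let $G_n^-$ denote its nontrivial pure inner form (if it exists). We then set $\epsilon_{G_n}=\pm1$ if $G_n=G_n^\pm.$ The theory is then expected to be largely analogous; however, we must also impose that when $G_n\in\{G_n^\pm\}$ is not quasi-split, the local Arthur parameters should be taken to be relevant for $G_n.$ Similar results would also be expected for pure inner forms of quasi-split unitary groups, general spin groups (or general pin groups), and metaplectic groups." — last sentence in the line comment; p0012:L4 "With Remark (rmk Arthur packet obstruction) in mind, we would expect Theorems (thm-count-block-temp) and (thm-count-temp) to hold more generally.") is recorded, not typed: the theorems are stated for the groups G_n of §2 (quasi-split, and the pure inner form G_n^- of a quasi-split non-split even orthogonal group).  Arthur-free, absorbed: [AM23], [HT01] / [Hen00] / [Sch13] (LLC for GL_d).  Premises: the book (all ranks), `AtobeApackets`, `AtobeWhichPackets`, `HLL`, `HLLtheta`,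 `LLCdesSpO`, `MoeglinImage`, `MoeglinMult1`. [cite: HazeltineKumarTung2026Fixed, §1 (p0003:L6, L11, L18, L25), §2.1 (p0005:L45-62), §2.2 (p0006:L141, p0007:L2-15), §2.3 (p0009:L17-20, p0013:L65), §2.4 (p0009:L48-53), Remarks 2.21 (p0010:L2-5), 3.9 (p0012:L4); HazeltineLiuLo2022, as [HLL22]; Atobe2023WhichPackets, as [Ato23]; Moeglin2011Image, as [Moe11b]] -/
def E_HKTfixedTempered : Prop :=
  (∀ N, ν.Everything N) → c₅.AtobeApackets → c₃₃.AtobeWhichPackets → c₂₆.HLL → c₅₅.HLLtheta → c₅₄.LLCdesSpO →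
    c₅₄.MoeglinImage → c₄₅.MoeglinMult1 → c₅₅.HKTfixedTempered

/-- B63 ⇐ THE BOOK ∧ B75 ∧ C168 ∧ B110 ∧ B93 ∧ B92 ∧ B5 ∧ B101 ∧ THE NODE `HLLtheta` ∧ B22 ∧ B91 ∧ B74 ∧ ATOBE – GAN (Sp – O) (`paper:arxiv-2607.23885`).  THE PACKETS: p0002:L50-52 "m sincem > n.In Arthur’s seminal work, to each local Arthur parameterψ ofG, Arthur attaches a local Arthur packet Π ψ which is a finite subset of Π(G) which satisfies the twisted endoscopic character identities ([2, Theorem 1.5.1])." — [2] = the book ↦ `∀ N, ν.Everything N` (also p0016:L32 "Theorem 3.22([2, Theorem 1.5.1]).We have that" […]); §2.2 p0007:L50-55 "WhenGis quasi-split, for a local Arthur parameterψ∈Ψ(G), Arthur constructed a finite multi-set Π ψ consisting of irreducible unitary representations ofGthat satisfy certain twisted endoscopic character identities ([2]). We call Πψ thelocal Arthur packet ofψ.WhenGis a pure inner form of a quasi-split group, e.g.G=H − m, we define Π ψ via quasi-split transfer (as in [33]). Mœglin showed that Π ψ is multiplicity-free ([33])." — [33] = B75 ↦ `Consumers45.MoeglinMult1`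 (multiplicity one AND the packets of the pure inner form H^-_m « via quasi-split transfer (as in [33]) » — B75's line, whose node `MoeglinDSHyp` tranche 45 types); p0008:L12 "Theorem 2.6([32, Proposition 5.1]).Letψ∈Ψ +(G)with decompositionψ=ψ ngp +" […] — [32] = C168 ↦ `Consumers54.MoeglinImage`; THE ADAMS LINE: p0008:L34-36 "Theorem 2.8([31, Theorem 6.1]).Suppose thatπ∈Π(G n)lies in a local Arthur packetΠ ψ for someψ∈Ψ +(Gn).Forα≫0,we haveθ ± −α(π)∈Π ψα." — [31] = B110 ↦ `Consumers54.MoeglinAdams` (cited as « Theorem 6.1 », cf. tranche 54); p0008:L41-44 "Theorem 2.9([8, Theorem 2]).Suppose thatπ∈Π(G n)lies in a local Arthur packet Πψ for someψ∈Ψ +(Gn).Ifθ up −α(π)̸= 0,thenθ up −α(π)∈Π ψα." p0008:L45-46 "We remark that while [8, Theorem 2] is stated forψ∈Ψ(G n); however, the extension to Ψ+(Gn) follows directly from [18, Lemma 2.33]." — [8] = B93 ↦ `Consumers54.BakicHanzerAdams`, [18] = B92 ↦ `Consumers54.HazeltineAdams` (Lemma 2.33; its Theorem 1.3 is context, p0003:L11);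 THE STRATEGY PARAGRAPH (p0004:L25-31, line comment: extended multi-segments and intersections « [3, 22, 23] », Adams' prediction on the going-up tower « [8, 31] », the first occurrence for tempered representations « [6] », the translation into extended multi-segments « [23] ») — [3] = B5 ↦ `Consumers5.AtobeApackets` (π(E) for Sp_2n, Thm 3.3, non-vanishing: p0014:L27 "We remark the above theorem was proven whenG= Sp 2n(F) in [22, Theorem 1.4]" / p0014:L29 "2m(F) in [23, Theorems 6.13 and 6.15]. With the above theorem in" […] p0014:L47 "The above theorem was proven whenG= Sp 2n(F) in [22, Theorem 1.7] and when" / p0014:L49 "2m(F) in [23, Theorem 7.3]." […] p0015:L3 "combinatorial nonvanishing conditions ([3, Theorems 3.6, 4.4] or [23, Theorem 6.17])"), [22] = B101 ↦ `Consumers26.HLL`, [23] ↦ the node `HLLtheta`; [6] = Atobe – Gan, Represent. Theory 21 (2017) is cited once, there, for the first occurrence of tempered representations on the going-up tower, which the body takes from [5] = Atobe – Gan, Invent. Math.: p0016:L47-50 "We now recall how to compute the first occurrence and the going-up tower for tempered representations using extended multi-segments. The following result is a straightforward adaptation of [5, Theorem 4.1] to our setting. Theorem 3.23([5, Theorem 4.1]).LetE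 ∈Rep(G n)be tempered and write" […] ↦ `Consumers54.AtobeGanThetaSpO` (the Sp – O instance of row B7; row B3's field `AtobeGanEven` is not made a premise); THE COUNT BEFORE THETA: Theorem 4.8 = [20, Theorem 3.7] (p0019:L27 "Theorem 4.8([20, Theorem 3.7]).LetE ∈VRep ρ(G)be a tempered extended multi-" […]) — [20] = B22 ↦ `HKTfixedTempered`; THEOREM 1.5's inputs: p0004:L22-24 "We note that whenπis generic or unramified, then|Ψ(π)|= 1 (see [21, Theorem 1.2] for the generic case and [29, Proposition 6.4] for the unramified case; see also [21, Proposition 5.5]). In particular, there are often non-θ-relevant pairs in these cases." p0025:L19 "and anyρ.Thenπ(E)is a generic representation and|Ψ(π)|= 1([21, Theorem 1.2])." […] p0025:L35-36 "Thenπ=π(E)for some extended multi-segmentE. By[29, Proposition 6.4](see also [21, Theorem 5.4 and Proposition 5.5]), we have that|Ψ(π)|= 1,ψ E is trivial on the" […] — [21] = B91 ↦ `HLLenhancedShahidi`, [29] = B74 ↦ `Consumers48.MoeglinComparaison`.  Context, not premises: [4] (Atobe, Crelle 804: « representations often lie in many local Arthur packets ([4, 22, 23]) », p0003:L16), [28]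 / [30] = B70 / B71 with [12, Theorem 7.5] (the known supercuspidal case: p0003:L42-44 "also supercuspidal ([27]). Results of Mœglin imply that|Ψ(θ up −mup,α(π)(π))|= 3|Ψ(π)| ([28, 30], see [12, Theorem 7.5]) and so we obtain many non-θ-relevant pairs than in the"), [27] Kudla, [1] Adams 1989, [9] / [11] / [12] / [16] (relative Langlands motivation), [19] (the authors' REU report).  Arthur-free, absorbed: Howe duality [25, 26, 14, 15, 36], [7] Atobe – Mínguez, [35] Sun – Zhu, [10], [13], [17] / [24] / [34].  Premises: the book (all ranks), `MoeglinMult1`, `MoeglinImage`, `MoeglinAdams`, `BakicHanzerAdams`, `HazeltineAdams`, `AtobeApackets`, `HLL`, `HLLtheta`, `AtobeGanThetaSpO`, `HKTfixedTempered`, `HLLenhancedShahidi`, `MoeglinComparaison`. [cite: HazeltineKumarTung2026Beyond, §1 (p0002:L50-52, p0003:L29-31, L42-44, p0004:L22-31, L40-44), §2 (p0007:L50-55, p0008:L12, L34-46), §3 (p0010:L26-53, p0014:L27-49, p0015:L3-43, p0016:L12-13, L32, L47-50), §4 (p0019:L27, p0025:L19, L35-36); Moeglin2011Adams, as [31]; BakicHanzer2022Adams,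 as [8]; Hazeltine2024Adams, as [18]; HazeltineKumarTung2026Fixed, as [20]; HazeltineLiuLo2024Shahidi, as [21]; AtobeGan2017, as [5]] -/
def E_HKTbeyondAdams : Prop :=
  (∀ N, ν.Everything N) → c₄₅.MoeglinMult1 → c₅₄.MoeglinImage → c₅₄.MoeglinAdams → c₅₄.BakicHanzerAdams →
    c₅₄.HazeltineAdams → c₅.AtobeApackets → c₂₆.HLL → c₅₅.HLLtheta → c₅₄.AtobeGanThetaSpO → c₅₅.HKTfixedTempered →
    c₅₅.HLLenhancedShahidi → c₄₈.MoeglinComparaison → c₅₅.HKTbeyondAdams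

/-- The fifty-fifth tranche of implications: B91's edge, B22's, B63's (the node `HLLtheta` has no supplier). [cite: HazeltineLiuLo2024Shahidi, Thm 1.2; HazeltineKumarTung2026Fixed, Thm 1.2; HazeltineKumarTung2026Beyond, Thms 1.4, 1.5 (each edge's source in its own docstring)] -/
structure Implications55 : Prop where
  shahidi : E_HLLenhancedShahidi ν c₂ c₅ c₂₆ c₃₃ c₄₅ c₄₇ c₅₄ c₅₅
  fixedTempered : E_HKTfixedTempered ν c₅ c₂₆ c₃₃ c₄₅ c₅₄ c₅₅
  beyond : E_HKTbeyondAdams ν c₅ c₂₆ c₄₅ c₄₈ c₅₄ c₅₅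

variable {ν μ κ c₂ c₅ c₁₁ c₁₃ c₁₄ c₂₆ c₃₃ c₄₃ c₄₄ c₄₅ c₄₇ c₄₈ c₅₁ c₅₄ c₅₅}

/-- THE THREE COUNTS FROM THE BOOK'S INPUTS, granting the typed Mœglin statements, the Adams line of tranche 54, the book-line
auxiliaries (B2, B5, Atobe, B101) and the unpublished node `HLLtheta`. [cite: HazeltineLiuLo2024Shahidi, Thm 1.2; HazeltineKumarTung2026Fixed, Thm 3.7; HazeltineKumarTung2026Beyond, Thm 4.11 (bookkeeping proved here)] -/
theorem packetCounts_of_inputs (W : Implications55 ν c₂ c₅ c₂₆ c₃₃ c₄₅ c₄₇ c₄₈ c₅₄ c₅₅) (A : BookInputs ν)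
    (hHLL : c₂₆.HLL) (hAt : c₅.AtobeApackets) (hWh : c₃₃.AtobeWhichPackets) (hM1 : c₄₅.MoeglinMult1)
    (hImg : c₅₄.MoeglinImage) (h72 : c₄₇.MoeglinPacketsComb) (hX2 : c₂.XuMoeglinParam) (h71 : c₄₇.MoeglinDiscretePackets)
    (hT : c₅₅.HLLtheta) (hLLC : c₅₄.LLCdesSpO) (hAd : c₅₄.MoeglinAdams) (hBH : c₅₄.BakicHanzerAdams)
    (hHz : c₅₄.HazeltineAdams) (h74 : c₄₈.MoeglinComparaison) (hAG : c₅₄.AtobeGanThetaSpO) :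
    c₅₅.HLLenhancedShahidi ∧ c₅₅.HKTfixedTempered ∧ c₅₅.HKTbeyondAdams :=
  have b := A.everything
  have sh := W.shahidi b hHLL hAt hWh hM1 hImg h72 hX2 h71
  have ft := W.fixedTempered b hAt hWh hHLL hT hLLC hImg hM1
  ⟨sh, ft, W.beyond b hM1 hImg hAd hBH hHz hAt hHLL hT hAG ft sh h74⟩

/-- THE THREE COUNTS FROM ONE NODE OF THE BOOK'S SIDE AND THE UNPUBLISHED SEQUEL: with the edges of tranches 45, 47, 48
(Mœglin's series from B75's node `MoeglinDSHyp`), of tranche 54 (the Adams line and the theta-side instances from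
`BookInputs`) and this tranche's, all three statements follow from `BookInputs`, `MoeglinDSHyp`, the book-line auxiliaries
(Mœglin – Tadić, B2, B5, Atobe, B101, C28, Luo — the last three through tranche 54's `adamsLine_of_node`) and `HLLtheta`. [cite: HazeltineKumarTung2026Beyond, p0004:L25-31; HazeltineKumarTung2026Fixed, p0007:L2; Moeglin2011Mult1, §1 (bookkeeping proved here)] -/
theorem packetCounts_of_node (W : Implications55 ν c₂ c₅ c₂₆ c₃₃ c₄₅ c₄₇ c₄₈ c₅₄ c₅₅)
    (W₅₄ : Implications54 ν c₂ c₅ c₁₁ c₂₆ c₃₃ c₄₅ c₄₇ c₄₈ c₅₁ c₅₄) (Y : Implications48 c₄₅ c₄₇ c₄₈)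
    (X : Implications47 ν c₄₅ c₄₇) (V : Implications45 ν μ κ c₁₃ c₁₄ c₄₃ c₄₄ c₄₅) (A : BookInputs ν)
    (hN : c₄₅.MoeglinDSHyp) (hMT : c₅₁.MoeglinTadicDS) (hX2 : c₂.XuMoeglinParam) (hAt : c₅.AtobeApackets)
    (hWh : c₃₃.AtobeWhichPackets) (hHLL : c₂₆.HLL) (hLi : c₁₁.LiMpApackets) (hLuo : c₁₁.LuoECR) (hT : c₅₅.HLLtheta) :
    c₅₅.HLLenhancedShahidi ∧ c₅₅.HKTfixedTempered ∧ c₅₅.HKTbeyondAdams :=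
  have s := moeglinSeries2006_2011_of_node Y X V A.published hN
  have ad := adamsLine_of_node W₅₄ Y X V A hN hMT hX2 hAt hWh hHLL hLi hLuo
  packetCounts_of_inputs W A hHLL hAt hWh s.1.1 ad.1 s.2.1.2.2.2 hX2 s.2.1.2.2.1 hT ad.2.2.2.1 ad.2.1
    ad.2.2.2.2.2.2.1 ad.2.2.2.2.2.2.2.1 s.2.2.2.2.2.2 ad.2.2.2.2.1

/-- THE COUNTS IN CONDITIONAL FORM, 2026: granting the book's edges and supply edges, every PUBLISHED input, B75's node, the
typed Mœglin series, the Adams line and the auxiliaries, the three statements follow from the seven 2024–2026 PREPRINT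
leaves of the book's DAG, its two UNWRITTEN weighted lemmas, AND the unpublished sequel `HLLtheta` (B91 does not use the
last).  None of the three papers prints a conditionality sentence. [cite: HazeltineKumarTung2026Fixed, p0005:L45; HazeltineKumarTung2026Beyond, p0002:L50-52; HazeltineLiuLo2024Shahidi, p0009:L22-25 (bookkeeping proved here)] -/
theorem packetCounts_conditional_form (W : Implications55 ν c₂ c₅ c₂₆ c₃₃ c₄₅ c₄₇ c₄₈ c₅₄ c₅₅) (B : ν.BookEdges)
    (S : ν.SupplyEdges) (P : ν.PublishedLeaves) (hHLL : c₂₆.HLL) (hAt : c₅.AtobeApackets) (hWh : c₃₃.AtobeWhichPackets)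
    (hM1 : c₄₅.MoeglinMult1) (hImg : c₅₄.MoeglinImage) (h72 : c₄₇.MoeglinPacketsComb) (hX2 : c₂.XuMoeglinParam)
    (h71 : c₄₇.MoeglinDiscretePackets) (hLLC : c₅₄.LLCdesSpO) (hAd : c₅₄.MoeglinAdams) (hBH : c₅₄.BakicHanzerAdams)
    (hHz : c₅₄.HazeltineAdams) (h74 : c₄₈.MoeglinComparaison) (hAG : c₅₄.AtobeGanThetaSpO) :
    ν.PreprintLeaves2026 → ν.UnwrittenLeaves → c₅₅.HLLenhancedShahidi ∧ (c₅₅.HLLtheta → c₅₅.HKTfixedTempered ∧ c₅₅.HKTbeyondAdams) :=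
  fun Q U =>
    have A : BookInputs ν := ⟨B, S, P, Q, U⟩
    ⟨W.shahidi A.everything hHLL hAt hWh hM1 hImg h72 hX2 h71, fun hT =>
      have all := packetCounts_of_inputs W A hHLL hAt hWh hM1 hImg h72 hX2 h71 hT hLLC hAd hBH hHz h74 hAG
      ⟨all.2.1, all.2.2⟩⟩

/-! ## Fifty-sixth tranche (v2, unit `pub-arthur-down-g28`): THETA AS A SUPPLIER — A9 `ChenZouLLCO`, A11 `ChenZouThetaPackets`,
B12 `AtobeFJ` (node `AtobeFJHyp`)

Context (`DOWNSTREAM.md` rows A9 l.159, A11 l.161 `[g2]` (graded G-i, never typed; A11 = the « 2021 companion » mis-attributed in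
row B93's parenthesis, cf. `GAPS.md` G-DN-318 (e)), B12 l.171 `[g2]` (G-ii); typed premises reused: `Consumers.ChenZou` (row A6,
tranche 1: Chen – Zou's multiplicity formula ⇐ book ∧ Mok), `Consumers45.MoeglinMult1` (B75), `Consumers2.XuMoeglinParam` (B2); compare
`Consumers46.ChenZouLLCU` (row A10, tranche 46: the unitary sibling of A9 ⇐ Mok) and `Consumers6.AGevenHyp` / `AtobeGanEven` (row B3,
tranche 6); `DOWNSTREAM2.md` block `[g28c]` (this tranche); texts staged with sha256 under `HOME/pub-arthur-down-g28/primaries/`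
(corpus TeX `paper:arxiv-2008.02632` (A9, 44 chunks), `paper:arxiv-2104.12354` (A11, 38 chunks), `paper:arxiv-1502.03528` (B12, 40
chunks), `paper:arxiv-1602.01297` (B3's text, for the comparison, 35 chunks)).  Loci: A9 p0002:L3, p0003:L3-7, L23, L31-34,
p0009:L113, p0014:L7-10, L101, p0015:L33-36, L86, p0016:L44-47, p0026:L7, p0027:L85, p0039:L3, L39, p0043; A11 p0002:L3, p0003:L5,
L19, p0004:L14-20, L38, L56-58, p0005:L1, p0008:L83, p0009:L119-126, p0010:L16, L22-31, p0011:L29, L66-77, p0015:L7, L32, L63, L74,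
p0016:L66, L80, p0027:L73, L110, p0028:L110, p0029:L9, p0037–p0038; B12 p0002:L3-7, p0004:L21-45, L49-60, L66-68, L70-85, L132-136,
p0005:L24-39, L49-58, p0010:L3-6, L154-155, p0012:L26-30, p0028:L126, p0039. -/

/-- Rows A9, A11, B12 of the census and one hypothesis node (B12's printed assumptions), as an arbitrary assignment of propositions; nothing about the content of a field is assumed. [cite: Arthur2013, downstream register of the cell, fifty-sixth tranche (structure only)] -/
structure Consumers56 where
  /-- A9 (census grade G-i): R. Chen – J. Zou, *Local Langlands correspondence for even orthogonal groups via theta lifts*, Selecta Math. (N.S.) 27 (2021) no. 5, Paper 88, doi:10.1007/s00029-021-00704-8 = arXiv:2008.02632 (corpus TeX `paper:arxiv-2008.02632`, 44 chunks; F non-archimedean of characteristic 0) — p0002:L3 "Using theta correspondence, we obtain a classification of the irreducible representations of an arbitrary even orthogonal group (i.e. the local Langlands correspondence) by deducing it from the local Langlands correspondence for symplectic groups due to Arthur. Moreover, we show that our classifications coincide with the local Langlands correspondence established by Arthur [MR3135650] and formulated precisely by Atobe-Gan [MR3708200] for quasi-split even orthogonal groups." THEOREM 4.4 (the main theorem: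 p0015:L33 "Next we state the local Langlands correspondence for even orthogonal groups, which is the main theorem of this paper." p0015:L35-36 "Theorem 4.4. Let $V_{2n}$ be a $2n$-dimensional orthogonal space and $\chi_V$ be the discriminant character of $V$." […] p0015:L86 "* (Local intertwining relation)" […] — an LLC for ⊔ O(V^•_2n) over all pure inner forms with the characterising properties: canonical bijections J_𝔚 with the characters of S_φ, generic members, change of Whittaker datum, temperedness / discreteness, the pure inner form read off z_φ, determinant twists, the LOCAL INTERTWINING RELATION for all pure inner forms, Langlands quotients, standard γ-factors, Plancherel measures), THEOREM 9.1 (the constructed LLC equals Arthur's 𝓛^A for the quasi-split O(V^+_2n)) and §11 (p0039:L3 "In [MR3135650], Arthur established a weaker version LLC for quasi-split special even orthogonal groups from the LLC for quasi-split even orthogonal groups. This was explicated by Atobe-Gan [MR3708200]. Since we now construct the LLC for even orthogonal groups, following Arthur's idea, we can deduce a weaker version LLC for special even orthogonal groups. We shall do it in this appendix." […] p0039:L39 "Desideratum (desideratumallspecial1) has not been established. However, following what Arthur did in [MR3135650], we can deduce a weaker version of Desideratum (desideratumallspecial1) as follows." — Theorem 11.2, the weak LLC for SO(V_2n)).  NOT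 in the theorem: the (twisted) endoscopic character identities (p0003:L33-34 "As in other instances where the LLC was shown using the theta correspondence (such as [MR2999299] and [MR2800725]), we do not show the (twisted) endoscopic character relations for the $L$-packets we constructed. To show that our $L$-packets satisfy the endoscopic character relations, one would need to appeal to the stable trace formula (or a simple form of it), as was done in [MR3267112] and [luo2020endoscopic].").  CENSUS NOTE: Theorem 4.4 delivers Atobe – Gan's Desideratum 3.6 for O(V_2n) (Represent. Theory 21 (2017), row B3) item by item EXCEPT item (4)'s « which satisfies the (twisted) endoscopic character identities » (arXiv:1602.01297 p0010:L117-121), together with their Hypothesis 3.10 (the LIR for all pure inner forms); row B3's node `Consumers6.AGevenHyp` (= Desideratum 3.6 ∧ Hypothesis 3.10 as printed) is therefore NOT supplied by A9 and no supply edge is typed. [cite: ChenZou2021LLCEvenOrth, Thm 4.4 (p0015:L33-36, L86), Thm 9.1 (p0037:L19), §11 (p0039:L3, L39); abstract (p0002:L3); p0003:L33-34] -/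
  ChenZouLLCO : Prop
  /-- A11 (census grade G-i; the arXiv text is the 2021 preprint): R. Chen – J. Zou, *Theta correspondence and Arthur packets*, arXiv:2104.12354 (corpus TeX `paper:arxiv-2104.12354`, 38 chunks; G = G(V) an even orthogonal or unitary group over a non-archimedean local field of characteristic 0, not necessarily quasi-split; H the symplectic / quasi-split unitary member of a dual pair in the stable range) — p0002:L3 "In spirit of [MR3866889], we have established an Arthur's multiplicity formula for even orthogonal or unitary groups with Witt index less than or equal to one. In that multiplicity formula, some local packets defined using the stable range theta lifts are involved. In this paper, we prove that at non-Archimedean places, the definition of the local packets involved in that multiplicity formula is independent of the choice of the dual-pairs used in their construction. Moreover, at those places where the groups are quasi-split, we prove that the local packets involved are the same as the local $A$-packets defined by Arthur/ Mok." […] The object: p0011:L29 "Now we recall the definition of the main object we want to study in this paper, the so-called “$\theta$-packet”, which is defined in [CZ2020AMFPIF]." THEOREM 2.8 p0011:L66-77 "Theorem 2.8. Let $F$ be a non-Archimedean local field. For all local $A$-parameter $\psi$ of $G=G(V)$ (with bounded image on the Weil group), we have: * the definition of the packet $\Pi_\psi^\theta(G)$ is indeed independent of the choice of $H=H(W_{(r)})$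 with $r>\dim V$; * if $V=V^+$, i.e. $G=G^*$ is quasi-split, then \Pi_\psi^\theta(G)=\Pi_\psi^A(G) as representations of $\calS_\psi\times G^*$." — with THEOREM 7.3 (LIR-B for θ-packets) and the consistency of the labelings (p0004:L58 "* Except for for the bijectivity, for our purpose, we also need to show the consistency of the “labelings”. To pass from Mœglin's parametrization to that of Arthur, one still needs to do some computions following [MR3679701]."); a refined form of Adams' prediction (B) in the stable range (the sentence, which names the conj., is in the line comment below); the non-quasi-split packets: p0004:L16 "* for quasi-split groups, our results imply the two terminologies are the same, so there is no harm; but for non quasi-split groups, at present $A$-packets (under the framework of Arthur, both locally and gloablly, cf. [MR3135650] Chapter 9, or [kaletha2014endoscopic] Chapter 1.6 and 1.7) are not avaliable, so we use $\theta$-packets for substitutions;" [cite: ChenZou2021ThetaPackets, Thm 2.8 (p0011:L66-77), Thm 7.3 (p0029:L49), §2.5 (p0011:L29); abstract (p0002:L3); p0004:L14-16, L58] -/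
  ChenZouThetaPackets : Prop
  /-- HYPOTHESIS NODE (row B12's printed assumptions): H. Atobe, Math. Ann. 371 (2018) (`paper:arxiv-1502.03528`) states its theorems under (LLC) p0004:L21-25 "(LLC) We assume the local Langlands correspondence for symplectic groups and special orthogonal groups in a form proposed by Vogan. (See (LLC).)" — p0010:L3-6 "Through this paper, we assume the local Langlands correspondence for symplectic and special orthogonal groups. See [A]. In this section, we summarize some of its properties which are used in this paper." —, (GPR) (the Gross – Prasad – Rallis characterisation of generic parameters by the adjoint L-function; line comment), (NQ) p0004:L38-41 "(NQ) Further, we assume some property of the local Langlands correspondence for non-quasi-split special orthogonal groups. (See (sec.intertwining).)" (p0028:L126 "The assumption (NQ) in (intro) is that Proposition (R v.s. S) (1) holds" […]), (IS) p0004:L43-45 "(IS) Finally, we assume an irreducibility condition for standard modules of $\Mp(W_{2n})$. (See (Mp).)" — and (B), the Bessel case (Waldspurger, Mœglin – Waldspurger; published, Arthur-free, NOT part of this node).  This node = (LLC) ∧ (GPR) ∧ (NQ) ∧ (IS) as printed.  The authors' remarks on their status: p0004:L71-74 "For quasi-split symplectic and special orthogonal groups, (LLC) has been established by Arthur [A]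 under some assumption on the stabilization of the twisted trace formula." p0004:L78-85 "For any quasi-split connected reductive groups, the assumption (GPR) has been established by [GI2]. The assumption (NQ) is an intertwining relation for non-quasi-split special orthogonal groups. For quasi-split orthogonal groups or symplectic groups, the intertwining relations easily follow from results of Arthur [A]. The properties analogous to (IS) have been established by Mœglin–Waldspurger [MW] for $\Sp(W_{2n})$ and $\SO(V_{m})$, and by Heiermann [H] for any quasi-split connected reductive groups." — the QUASI-SPLIT part of (LLC) and the quasi-split intertwining relations are the book's (« under some assumption on the stabilization of the twisted trace formula »: the paper's conditionality sentence), (GPR) is supplied by Gan – Ichino 2016 (row B18's paper, Appendix B; not B18's typed Theorem 1.3: (des4) « … » p0010:L155 "in general by [GI2]."; first half of the sentence in the line comment), (IS) by Mœglin – Waldspurger / Heiermann; (LLC) for the NON-quasi-split special orthogonal groups in Vogan's form and (NQ) have no supplier in the paper (2015) — no supply edge is typed (compare row B3's `AGevenHyp`, tranche 6; Mœglin – Renard 2018 = row A8-p `Consumers13.MRpadicOrth` later gave the non-quasi-split orthogonal LLC, a candidate supplier not asserted by any typed text). [cite: Atobe2018FJ, §1 (p0004:L21-45, L70-85), §3 (p0010:L3-6,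 L154-155), §7 (p0028:L126) (node; no supplier)] -/
  AtobeFJHyp : Prop
  /-- B12, the theorems AS STATED (census grade G-ii): H. Atobe, *The local theta correspondence and the local Gan – Gross – Prasad conj. for the symplectic-metaplectic case* (title word abbreviated; exact title in the line comment below), Math. Ann. 371 (2018) no. 1-2, 225–295, doi:10.1007/s00208-017-1620-7 = arXiv:1502.03528 (corpus TeX `paper:arxiv-1502.03528`, 40 chunks; F non-archimedean of characteristic 0) — THEOREM 1.3 p0004:L49-52 "Theorem 1.3. Assume $(LLC)$, $(GPR)$ and $(B)$. Let $\phi$ and $\cl{\phi}$ be generic $L$-parameters of $\Sp(W_{2n})$ and $\Mp(W_{2n})$, respectively." p0004:L54-55 "* If $\phi$ and $\cl{\phi}$ are tempered, then $(FJ)$ is true for $\phi\times\cl{\phi}$." p0004:L57-60 "* If we further assume $(NQ)$, $(IS)$ and that there exists a quadratic character $\chi$ of $F^\times$ such that the local $L$-function $L(s,\phi\otimes\chi)$ is regular at $s=1$, then $(FJ)$ is true for $\phi\times\cl{\phi}$." ((FJ) = the Fourier – Jacobi case of the local GGP statement for Mp(W_2n) × Sp(W_2n)); COROLLARY 1.4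 (GGP's Conj. 17.1 / 17.3 under the same assumptions; line comment); THEOREM 1.7 (Prasad's (P1): p0004:L132-136 "(P1) Likewise, if $\pi$ has parameter $(\phi_\pi,\eta_\pi)$ and $\sigma\coloneqq\theta_{\psi,V_{2n+2},W_{2n}}(\pi)|\SO(V_{2n+2})$ has parameter $(\phi_\sigma,\eta_\sigma)$, then $(\phi_\sigma,\eta_\sigma)$ can be described in terms of $(\phi_\pi,\eta_\pi)$ explicitly."; statement « (P1) holds » in the line comment) and (P2), with PROPOSITION 1.6 (p0005:L24-25 "Proposition 1.6. We have the following:" […] p0005:L38-39 "* $(\text{ [GS1] and [GI1]})$ The statements $(Mp)$, $(weak\ P1)$ and $(weak\ P2)$ hold.").  Stated under the node `AtobeFJHyp` and (B). [cite: Atobe2018FJ, Thm 1.3 (p0004:L49-60), Cor. 1.4 (p0004:L66-68), Prop. 1.6 (p0005:L24-39), Thm 1.7 (p0005:L49-50), (P1) (p0004:L132-136)] -/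
  AtobeFJ : Prop

variable (ν : Nodes) (μ : Mok2015.Nodes) (κ : KMSW2014.Nodes) (c : Consumers) (c₂ : Consumers2) (c₄₅ : Consumers45)
  (c₅₆ : Consumers56)

-- Verbatim, the sentences and titles the docstring lint keeps out of docstrings (each names a conj.) and the bibliography entries.
-- A9 (`paper:arxiv-2008.02632`), §1: p0003:L4-5 "of characteristic 0 (the local Langlands correspondence) as well as a description of the automorphic discrete spectra of these groups over number fields (the Arthur conjecture). He proved these results by using the theory of endoscopy and the stable trace formula. Following Arthur's method, Mok established the same results for quasi-split unitary groups [MR3338302]. Later in [MR3708200], Atobe-Gan formulated precisely the local Langlands correspondence (LLC for short) for quasi-split even orthogonal groups and their pure inner forms (using Vogan $L$-packet [MR1216197]). They highlighted that Arthur's results will imply the LLC for quasi-split even orthogonal groups. They also formulated the local intertwining relation (see section (LIR)), which plays a key role in LLC." / bibliography: p0043:L5 "[MR3708200] Hiraku Atobe and Wee~Teck Gan. \newblock On the local {L}anglands correspondence and {A}rthur conjecture for even orthogonal groups. \newblock {\em Represent. Theory}, 21:354--415, 2017." / p0043:L7 "[MR3135650] James Arthur. \newblock {\em The endoscopic classification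 of representations}, volume~61 of {\em American Mathematical Society Colloquium Publications}. \newblock American Mathematical Society, Providence, RI, 2013. \newblock Orthogonal and symplectic groups." / p0043:L9 "[MR3801418] Hiraku Atobe. \newblock On the uniqueness of generic representations in an {$L$}-packet. \newblock {\em Int. Math. Res. Not. IMRN}, (23):7051--7068, 2017." / p0043:L11 "[MR3788848] Hiraku Atobe. \newblock The local theta correspondence and the local {G}an-{G}ross-{P}rasad conjecture for the symplectic-metaplectic case. \newblock {\em Math. Ann.}, 371(1-2):225--295, 2018." / p0043:L17 "[CZ2] Rui Chen and Jialiang Zou. \newblock Local langlands correspondence for unitary groups via theta lifts. \newblock {\em To be appear}, 2020." / p0043:L21 "[MR3166215] Wee~Teck Gan and Atsushi Ichino. \newblock Formal degrees and local theta correspondence. \newblock {\em Invent. Math.}, 195(3):509--672, 2014." / p0043:L53 "[MR3338302] Chung~Pang Mok. \newblock Endoscopic classification of representations of quasi-split unitary groups. \newblock {\em Mem. Amer. Math. Soc.}, 235(1108):vi+248, 2015."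
-- A11 (`paper:arxiv-2104.12354`): p0004:L14 "Our results in this paper can be more or less regarded as a refined version of Conjecture (Intro.Adams.Conjecture) (B) here: we not only prove the bijection between packets as (multi) sets, we also show the consistency of “labelings”, i.e. the characters of component groups attached to the representations inside the packets. However, in our results, we use the terminology “$\theta$-packets” rather than “$A$-packets”, due to two reasons:" / p0004:L20 "We should also mention to readers that Mœglin has done many wonderful works on Conjeture (Intro.Adams.Conjecture) in [MR2906916], based on her explicit construction of local $A$-packets for classical groups. Next we briefly recall her results." / p0004:L38 "if the LHS and the RHS are both non-zero (see [MR2906916] 5.2 Théorème). She also showed some non-vanishing criterion for the representation $\pi\left(\psi,\underline{t},\underline{\eta}\right)$ along the proof. Hence in some sense, she has proved Conjecture (Intro.Adams.Conjecture) (A) under her assumptions. Her method is purely local. To prove these results, she mastered the Kudla's filtration and Jacquet modules very carefully. Moreover, she pointed out that Conjecture (Intro.Adams.Conjecture) (A) is generally not true by giving some counter-examples." / bibliography: p0037:L7 "[MR3135650] James Arthur. \newblock {\em The endoscopic classification of representations}, volume~61 of {\em American Mathematical Society Colloquium Publications}. \newblock American Mathematical Society, Providence, RI, 2013. \newblock Orthogonal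 and symplectic groups." / p0037:L17 "[CZ2020AMFPIF] Rui Chen and Jialiang Zou. \newblock Arthur's multiplicity formula for even orthogonal and unitary groups. \newblock {\em arXiv preprint arXiv:2103.07956}, 2021." / p0037:L23 "[MR3866889] Wee~Teck Gan and Atsushi Ichino. \newblock The {S}himura-{W}aldspurger correspondence for {${Mp}_{2n}$}. \newblock {\em Ann. of Math. (2)}, 188(3):965--1016, 2018." / p0037:L35 "[kaletha2014endoscopic] Tasho Kaletha, Alberto Minguez, Sug~Woo Shin, and Paul-James White. \newblock Endoscopic classification of representations: inner forms of unitary groups. \newblock {\em arXiv preprint arXiv:1409.3731}, 2014." / p0037:L51 "[MR2767522] C.~M{\oe}glin. \newblock Multiplicit\'{e} 1 dans les paquets d'{A}rthur aux places {$p$}-adiques. \newblock In {\em On certain {$L$}-functions}, volume~13 of {\em Clay Math. Proc.}, pages 333--374. Amer. Math. Soc., Providence, RI, 2011." / p0037:L53 "[MR2906916] Colette M{\oe}glin. \newblock Conjecture d'{A}dams pour la correspondance de {H}owe et filtration de {K}udla. \newblock In {\em Arithmetic geometry and automorphic forms}, volume~19 of {\em Adv. Lect. Math. (ALM)}, pages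 445--503. Int. Press, Somerville, MA, 2011." / p0037:L55 "[MR3338302] Chung~Pang Mok. \newblock Endoscopic classification of representations of quasi-split unitary groups. \newblock {\em Mem. Amer. Math. Soc.}, 235(1108):vi+248, 2015." / p0038:L7 "[MR3679701] Bin Xu. \newblock On {M}\oe glin's parametrization of {A}rthur packets for {$p$}-adic quasisplit {$Sp(N)$} and {$SO(N)$}. \newblock {\em Canad. J. Math.}, 69(4):890--960, 2017."
-- B12 (`paper:arxiv-1502.03528`), title p0001:L1 « The local theta correspondence and the local Gan–Gross–Prasad conjecture for the symplectic-metaplectic case »; abstract p0002:L3-7 "We prove the local Gan–Gross–Prasad conjecture for the symplectic-metaplectic case under some assumptions. This is the last case of the local Gan–Gross–Prasad conjectures. We also prove two of Prasad's conjectures on the local theta correspondence in the almost equal rank case." / (GPR): p0004:L27-30 "(GPR) In addition, we assume a conjecture of Gross–Prasad and Rallis, which characterizes the generic $L$-parameters in terms of the local adjoint $L$-function. (See (LLCproperty).)" p0010:L154 "The property ((des4)) is a conjecture of Gross–Prasad and Rallis (GPR), which was proven" / [GI2]: p0005:L52-54 "In [GI2], Gan–Ichino proved Prasad's conjecture for unitary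 dual pairs, and conclude the GGP conjecture for the skew-hermitian case. The proof of Prasad's conjecture for unitary dual pairs (for tempered case) consists two steps;" / p0005:L58 "However, one can prove Prasad's conjecture by using only the local argument." / (B): p0004:L32-36 "(B) We use the works of Waldspurger [Wa2], [Wa3], [Wa4], [Wa5] and Mœglin–Waldspurger [MW] on the Bessel case of the GGP conjecture. (See (GGPforSO).)" / Cor. 1.4: p0004:L66-68 "Corollary 1.4. Under the same assumptions as Theorem $(main)$, Conjecture $17.1$ and $17.3$ in [GGP] are true." / Thm 1.7: p0005:L49-50 "Theorem 1.7. Conjecture $(P1)$ holds." / bibliography: p0039:L12-15 "\par [A] {J. Arthur}, {\em The endoscopic classification of representations: orthogonal and symplectic groups}, {\it American Mathematical Society Colloquium Publications}, {\bf 61}, 2013." / p0039:L49-52 "\par [GI1] {W. T. Gan and A. Ichino}, {\em Formal degrees and local theta correspondence}, {\it Invent. Math}. {\bf195} (2014), no.~3, 509--672." / p0039:L54-57 "\par [GI2] {W. T. Gan and A. Ichino}, {\em The Gross--Prasad conjecture and local theta correspondence}, arXiv:1409.6824v2." / p0039:L59-62 "\par [GS1] {W. T. Gan and G. Savin}, {\em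 Representations of metaplectic groups $\mathrm{I}$: epsilon dichotomy and local Langlands correspondence}, {\it Compos. Math}. {\bf 148} (2012), 1655--1694."

/-- A9 ⇐ THE BOOK (`paper:arxiv-2008.02632`).  THE INPUT: p0003:L3 "In the monumental book [MR3135650], Arthur obtained a classification of irreducible representations of symplectic and quasi-split special orthogonal groups over local fields" […]; p0003:L7 "The main goal of this paper is to construct an LLC for quasi-split even orthogonal groups and their pure inner forms. We also prove several desired properties of this construction; in particular, we prove the local intertwining relation stated in [MR3708200]." p0003:L7 "Moreover, we shall show that our LLC is the same as Arthur's LLC in the quasi-split case." p0003:L23 "We construct such a LLC for even orthogonal groups by transporting Arthur's LLC for symplectic groups via theta correspondence." — §4.3 p0014:L7 "We first describe the local Langlands correspondence for symplectic groups. This was proved by Arthur [MR3135650], with supplements by many others." p0014:L9-10 "Theorem 4.2. Let $W_{2n}$ be a $2n$-dimensional symplectic space." […] (the LLC for Sp(W_2n) with its local intertwining relation: p0014:L101 "The local intertwining relation we used here is the same as in [MR3788848], which is a little bit different from the local intertwining relation formulated by Arthur [MR3135650]. In [MR3801418], Atobe proved that the local intertwining relation we used here is a consequence of the local intertwining relation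 formulated by Arthur." — [MR3788848] = H. Atobe, Math. Ann. 371 (2018) = row B12 (the FORMULATION of the LIR), [MR3801418] = H. Atobe, IMRN 2017 = row B19 (the implication from Arthur's LIR; book-fed): the premise is the book's Theorems 1.5.1 / 2.2.1 / 2.4.1 for Sp_2n at all ranks ↦ `∀ N, ν.Everything N`); §4.4 p0016:L44 "The LLC for quasi-split even orthogonal groups has been proved by Arthur [MR3135650] and was explicated in Atobe-Gan [MR3708200]. More precisely, they proved" p0016:L46-47 "Theorem 4.5. Let $V^+_{2n}=V_{2n}$ be the orthogonal space associated to $(d,1)$." […] — the comparison Theorem 9.1 and §11 use the book's LLC for the quasi-split O(V^+_2n) / SO(V_2n) as explicated by [MR3708200] = Atobe – Gan, Represent. Theory 21 (2017) (row B3: the FORMULATION, Desideratum 3.6, and the explication of [Ar]; B3's node `AGevenHyp` and its conditional theorems are not used); the analysis: p0026:L7 "In this subsection, we define the normalized intertwining operators. We mainly follow [MR3135650], [MR3708200] and [MR3788848]." […] p0027:L85 "The case when $G$ is symplectic group or quasi-split even orthogonal group is proved in [MR3135650]. When $G$ is even orthogonal group, we will give a proof in Appendix (appendixa1) based on the explicit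 formula for Plancherel measures." […]; p0009:L113 "We collect some results from [MR3166215] which will be frequently used in this paper. We emphasize that the proofs of these results are independent of the local Langlands correspondence." — [MR3166215] = Gan – Ichino, Invent. Math. 195 (2014) (formal degrees; LLC-free), Gan – Savin 2012, Gan – Takeda, Gan – Sun, Waldspurger (Howe duality), Kudla, Lapid – Rallis γ-factors, GGP 2012 (parameters): Arthur-free, absorbed.  Context, not premises: Mok's memoir (p0003:L5, the unitary analogue), [CZ2] = row A10 (the parallel unitary paper, typed ⇐ Mok in tranche 46).  Premise: the book (all ranks). [cite: ChenZou2021LLCEvenOrth, §1 (p0003:L3, L7, L23), §3 (p0009:L113), §4.3 (p0014:L7-10, L101), §4.4 (p0016:L44-47), §7 (p0026:L7, p0027:L85); Arthur2013, Thms 1.5.1, 2.2.1, 2.4.1 as cited] -/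
def E_ChenZouLLCO : Prop := (∀ N, ν.Everything N) → c₅₆.ChenZouLLCO

/-- A11 ⇐ THE BOOK (LOCAL AND GLOBAL) ∧ MOK'S MEMOIR (LOCAL AND GLOBAL) ∧ A6 ∧ B75 ∧ B2 (`paper:arxiv-2104.12354`).  THE GLOBAL INPUT: p0003:L5 "When $G$ is a quasi-split classical group, this question is already very well-studied by Arthur [MR3135650] and Mok [MR3338302]. Basically, they decomposed $L_{disc}^2(G)$ into some summands called “near equivalence classes”, and describe each of these summands using the so called “Arthur's multiplicity formula”." […] p0003:L19 "In our previous paper [CZ2020AMFPIF], we put $G$ to be an even orthogonal or unitary group (not necessarily quasi-split), and $H$ be a symplectic or quasi-split unitary group according to $G$. We established the same results as in [MR3866889]. Besides, we also observed that the multiplicity preservation (i.e. equality ((Intro.Multi.Preserve))) also holds if the Witt index of $G$ is less than or equal to one. Hence we obtained a description for the full automorphic discrete spectra of those even orthogonal or unitary groups, by “pulling back” the Arthur's multiplicity formula for $H$ to $G$ through the theta lift." — [CZ2020AMFPIF] = Chen – Zou, *Arthur's multiplicity formula for even orthogonal and unitary groups* = row A6 ↦ `Consumers.ChenZou` (tranche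 1: ⇐ book ∧ Mok); THE METHOD: p0005:L1 "Our idea of the proof is very simple: we use global methods as much as possible. For quasi-split classical groups, the Arthur's multiplicity formula implies that any localization of an irreducible unitary representation occuring in the automorphic discrete spectrum lies in a local $A$-packet." — §2.3 p0008:L83 "We briefly recall some terminologies and results from [MR3135650] (also [MR3708200]), [MR3338302], and some other papers." p0009:L119-120 "Theorem 2.5. There exists a decomposition" [L²_disc(G) = ⊕_{ψ ∈ Ψ_ell(G)} L²_ψ(G)] p0009:L126 "where $L^2_\psi(G)$ is a full near equivalence class of irreducible representations $\pi$ in $L^2_{disc}(G)$ such that the $L$-parameter of $\pi_v$ is $\phi_{\psi_v}$ for almost all places $v$ of $F$." p0010:L22 "Then the main global Theorems in [MR3135650] and [MR3338302] assert that" p0010:L24-25 "Theorem 2.6. Let $\psi$ be an elliptic $A$-parameter for $G^*$. Then we have the decomposition" [L²_ψ(G*) = ⊕_{π ∈ Π_ψ^A(G*, ε_ψ)} π] p0010:L31 "Similarly, one can define the global $A$-parameters for the group $H$, and for a global elliptic $A$-parameter $\psi_H$ of $H$, one can define the associated global $A$-packets by gluing local $A$-packets in the same manner. Again, according to Arthur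 and Mok's works, Theorem (Decompose.NEC) and Theorem (AMF.QS) also holds for $H$." (p0010:L16 "where $x\in\calS_\psi$ and $x_v$ is the localization of $x$ at $v$. We can also define the so-called canonical sign character $\epsilon_\psi\in\wh{\calS_\psi}$ following [MR3135650] page 47, or [MR3338302] page 29. We put") — [MR3135650] ↦ the book at all ranks, its GLOBAL theorems included (`∀ N, ν.Everything N` covers Theorems 1.5.1–1.5.2 and Chapters 2–8), [MR3338302] = Mok's memoir at all ranks ↦ `∀ N, μ.Everything N` (Case U: H a quasi-split unitary group); THE LOCAL INPUTS: p0016:L66 "Finally the $A$-packet associated to a general $\psi$ can be constructed from the good parity case by using parabolic inductions. For this part, readers may also consult [MR3135650] Proposition 2.4.3, or [MR3338302] Proposition 3.4.4." p0016:L80 "In Case $O$, this is follows from [MR3135650] Lemma 6.2.2. In Case $U$, this follows from [MR3004076] Theorem 5.13. (In Case $U$, readers may also consult [MR3573972] Section 6.4; if $\dot F$ has enough real places different from $u$, then this also follows from [MR3338302] Lemma 7.2.3.)" (Shin's Plancherel density theorem: Arthur-free, absorbed); §7 p0027:L110 "At least when $G=G^*$ is quasi-split, this should follow from [MR3135650]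 Proposition 2.3.1 in Case $O$, or [MR3338302] Proposition 3.3.1 in Case $U$. We shall prove this lemma in the next section for $G$ is non quasi-split." […] p0028:L110 "The first and second claims directly follow from [MR3135650] Proposition 2.4.3 in Case $O$, and [MR3338302] Proposition 3.4.4 in Case $U$. We show the last claim. Indeed, this proof is almost the same as that of [MR3801418] Theorem 2.4. In that paper, Atobe proved this LIR-B in the tempered case." […] p0029:L9 "By applying the endoscopic character identity ( [MR3135650] Theorem 2.2.1 in Case $O$ or [MR3338302] Theorem 3.2.1 in Case $U$) and the original local intertwining relation ( [MR3135650] Theoerem 2.4.1 in Case $O$ or [MR3338302] Theorem 3.4.3 in Case $U$) to $u$, we obtain" […] (book / Mok again; [MR3801418] = Atobe IMRN = row B19, book-fed, absorbed); MŒGLIN AND XU: §4.1 p0015:L7 "We first recall some results due to Mœglin in [MR2767522]. Readers may also consult the paper [MR3679701]. We emphasize that our proof of Theorem (Main.Theorem.Packets) relies on these results." […] p0015:L32 "For $\psi\in\Psi(G)$ and $\eta\in\wh{\overline{\calS_\psi}}$, Mœglin constructed a finite-length semi-simple smooth representation $\pi_M(\psi,\eta)$ of $G$." […] — [MR2767522]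 = B75 ↦ `Consumers45.MoeglinMult1` (her explicit construction, for orthogonal, symplectic AND unitary G); p0015:L63 "According to Mœglin's construction, we have (cf. [MR3679701] Definition 6.3)" […] p0015:L74 "The second remarkable fact is (cf. [MR3679701] Theorem 6.1)" […] p0004:L58 "* Except for for the bijectivity, for our purpose, we also need to show the consistency of the “labelings”. To pass from Mœglin's parametrization to that of Arthur, one still needs to do some computions following [MR3679701]." — [MR3679701] = B2 ↦ `Consumers2.XuMoeglinParam`.  Context, not premises: [MR2906916] = B110 (her Adams theorems, recalled §1.3 and re-proved here by global means in the stable range: line comment), [kaletha2014endoscopic] = KMSW and [MR3135650, Ch. 9] (the non-quasi-split packets « not avaliable »: p0004:L16 "* for quasi-split groups, our results imply the two terminologies are the same, so there is no harm; but for non quasi-split groups, at present $A$-packets (under the framework of Arthur, both locally and gloablly, cf. [MR3135650] Chapter 9, or [kaletha2014endoscopic] Chapter 1.6 and 1.7) are not avaliable, so we use $\theta$-packets for substitutions;"), p0003:L5 "For non quasi-split groups, Arthur has proposed some strategies to attack this question using the trace formula." (context), [MR3947270] = B24 (archimedean, Remark 2.9), [MR3866889] = Gan – Ichino 2018 (the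 Mp_2n model of the method), [MR3573972] §7.3 (p0027:L73 "In [MR3573972] Section 7.3, it was shown" […]: a computation of Weyl-element representatives; Arthur-free, absorbed as in tranche 46's `E_ChenZouLLCU`), [MR3708200] (explication).  Howe, J.-S. Li (low rank), Kudla – Rallis, Sun – Zhu, Gan – Takeda: Arthur-free, absorbed.  Premises: the book (all ranks), Mok (all ranks), `ChenZou`, `MoeglinMult1`, `XuMoeglinParam`. [cite: ChenZou2021ThetaPackets, §1 (p0003:L5, L19, p0004:L16, L58, p0005:L1), §2.3 (p0008:L83, p0009:L119-126, p0010:L16, L22-31), §4 (p0015:L7, L32, L63, L74, p0016:L66, L80), §7 (p0027:L73, L110, p0028:L110, p0029:L9); ChenZou2025AMF, as [CZ2020AMFPIF]; Mok2012, as [MR3338302]] -/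
def E_ChenZouThetaPackets : Prop :=
  (∀ N, ν.Everything N) → (∀ N, μ.Everything N) → c.ChenZou → c₄₅.MoeglinMult1 → c₂.XuMoeglinParam →
    c₅₆.ChenZouThetaPackets

/-- B12, AS STATED: Theorems 1.3 / 1.4 / 1.7 follow from the node (LLC) ∧ (GPR) ∧ (NQ) ∧ (IS) and the published Bessel case (B) (Waldspurger [Wa2]–[Wa5], Mœglin – Waldspurger [MW]: Arthur-free, absorbed), with Gan – Savin's metaplectic LLC and Gan – Ichino 2014 / 2016 (p0005:L55-57 "a global argument with using Arthur's multiplicity formula, and a local argument with using intertwining relations. The use of the recently established Arthur's multiplicity formula is the main novelty." — method; the unitary case is row B18) as published, absorbed inputs; the book enters only through the node's quasi-split part (p0012:L26-27 "By Kottwitz's isomorphism, we have $\#H^1(F,\Sp(W_{2n}))=1$, so that there are no non-trivial pure inner forms of $G=\Sp(W_{2n})$." p0012:L29-30 "By [A], for $\phi\in\cl\Phi_\temp(\Sp(W_{2n}))$," […]).  The edge has NO DAG premise, exactly as row B3's `E_AtobeGanEven` (tranche 6).  Premise: `AtobeFJHyp`. [cite: Atobe2018FJ, Thms 1.3, 1.4,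 1.7 with §1 (p0004:L49-68, p0005:L24-58), §3.4 (p0012:L26-30)] -/
def E_AtobeFJ : Prop := c₅₆.AtobeFJHyp → c₅₆.AtobeFJ

/-- The fifty-sixth tranche of implications: A9's edge, A11's, B12's (the node `AtobeFJHyp` has no supplier). [cite: ChenZou2021LLCEvenOrth, Thm 4.4; ChenZou2021ThetaPackets, Thm 2.8; Atobe2018FJ, Thm 1.3 (each edge's source in its own docstring)] -/
structure Implications56 : Prop where
  llcO : E_ChenZouLLCO ν c₅₆
  thetaPackets : E_ChenZouThetaPackets ν μ c c₂ c₄₅ c₅₆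
  atobeFJ : E_AtobeFJ c₅₆

variable {ν μ κ c c₂ c₄₅ c₅₆}

/-- A9 FROM THE BOOK'S INPUTS ALONE: the LLC for all even orthogonal groups, pure inner forms included, rests on the book's
24 leaves and on nothing of Mok / KMSW (contrast its unitary sibling A10, tranche 46: Mok's inputs alone). [cite: ChenZou2021LLCEvenOrth, Thm 4.4 with p0014:L7 (bookkeeping proved here)] -/
theorem chenZouLLCO_of_inputs (W : Implications56 ν μ c c₂ c₄₅ c₅₆) (A : BookInputs ν) : c₅₆.ChenZouLLCO :=
  W.llcO A.everything

/-- A11 FROM THE BOOK'S AND MOK'S INPUTS, with the edges of tranche 1 (A6 ⇐ book ∧ Mok) and the granted Mœglin / Xu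
statements: the θ-packets theorem rests on every leaf of the book AND of Mok's memoir. [cite: ChenZou2021ThetaPackets, Thm 2.8 with p0003:L5, p0010:L22 (bookkeeping proved here)] -/
theorem chenZouThetaPackets_of_inputs (W : Implications56 ν μ c c₂ c₄₅ c₅₆) (I : Implications ν μ κ c)
    (A : BookInputs ν) (M : MokInputs μ) (hM1 : c₄₅.MoeglinMult1) (hX2 : c₂.XuMoeglinParam) :
    c₅₆.ChenZouThetaPackets :=
  W.thetaPackets A.everything M.everything (chenZou_of_leaves I A M) hM1 hX2

/-- THE TRANCHE FROM ITS INPUTS: A9 and A11 from `BookInputs`, `MokInputs`, tranche 1's edges and the two granted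
auxiliaries; B12 from its node. [cite: ChenZou2021LLCEvenOrth, Thm 4.4; ChenZou2021ThetaPackets, Thm 2.8; Atobe2018FJ, Thm 1.3 (bookkeeping proved here)] -/
theorem thetaSupplier_of_inputs (W : Implications56 ν μ c c₂ c₄₅ c₅₆) (I : Implications ν μ κ c) (A : BookInputs ν)
    (M : MokInputs μ) (hM1 : c₄₅.MoeglinMult1) (hX2 : c₂.XuMoeglinParam) (hH : c₅₆.AtobeFJHyp) :
    c₅₆.ChenZouLLCO ∧ c₅₆.ChenZouThetaPackets ∧ c₅₆.AtobeFJ :=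
  ⟨chenZouLLCO_of_inputs W A, chenZouThetaPackets_of_inputs W I A M hM1 hX2, W.atobeFJ hH⟩

/-- THE TRANCHE IN CONDITIONAL FORM, 2026: granting the edges, the supply edges and every PUBLISHED input of the book and
of Mok's memoir, tranche 1's edges and the two granted auxiliaries, A9 follows from the book's seven preprint leaves and
two unwritten weighted lemmas; A11 from those AND Mok's open leaves (`μ.PreprintLeaves2026`, `μ.UnwrittenLeaves`); B12 from
its node alone.  A9 and A11 print no conditionality sentence; B12 prints its hypotheses and the book's. [cite: ChenZou2021LLCEvenOrth, p0003:L3; ChenZou2021ThetaPackets, p0003:L5; Atobe2018FJ, p0004:L71-74 (bookkeeping proved here)] -/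
theorem thetaSupplier_conditional_form (W : Implications56 ν μ c c₂ c₄₅ c₅₆) (I : Implications ν μ κ c) (B : ν.BookEdges)
    (S : ν.SupplyEdges) (P : ν.PublishedLeaves) (Bμ : μ.SectionEdges) (Sμ : μ.SupplyEdges) (Pμ : μ.PublishedLeaves)
    (hM1 : c₄₅.MoeglinMult1) (hX2 : c₂.XuMoeglinParam) :
    (ν.PreprintLeaves2026 → ν.UnwrittenLeaves → c₅₆.ChenZouLLCO) ∧
      (ν.PreprintLeaves2026 → ν.UnwrittenLeaves → μ.PreprintLeaves2026 → μ.UnwrittenLeaves → c₅₆.ChenZouThetaPackets) ∧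
      (c₅₆.AtobeFJHyp → c₅₆.AtobeFJ) :=
  ⟨fun Q U => chenZouLLCO_of_inputs W ⟨B, S, P, Q, U⟩,
    fun Q U Qμ Uμ => chenZouThetaPackets_of_inputs W I ⟨B, S, P, Q, U⟩ ⟨Bμ, Sμ, Pμ, Qμ, Uμ⟩ hM1 hX2, W.atobeFJ⟩

/-! ## Fifty-seventh tranche (v3, unit `pub-arthur-down-g29`): THE METAPLECTIC LINE, II — the theta-theoretic LLC for Mp_2n and its
intertwining relation: nodes `LLCoddSO`, `LIRoddSO`, `GSHypBC`; NEW row B112 `GanSavinLLCMp` / `GanSavinPsi`; B8 `IshimotoLIRMp`;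
B57 `LiPsiVariation`; supply edges from Ishimoto 2020 §5 and Ishimoto 2024 (row A5) §1

Context (`DOWNSTREAM.md` rows B8 l.167 `[g2]` (G-i, never typed), B57 l.482 `[g5c]` (G-i, never typed); Gan – Savin 2012 had no census
row — it was « absorbed » as Arthur-free in `E_AtobeApackets` (tranche 5), `E_LuoECR` (tranche 11), tranche 54's Mp – O instances and
`E_AtobeFJ` (tranche 56) — and is registered here as NEW row B112; typed premises reused: `Consumers.IshimotoGeneric` (row A5, tranche 1),
`Consumers11.LuoECR` (row B11, tranche 11), `Consumers13.MRpadicOrth` (row A8-p, tranche 13); compare `Consumers.GanIchino11` / `GanIchino14`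
(row C1) and `Consumers11.LiMpApackets` (C28), which cite [GS12] / [Is20] as inputs; `DOWNSTREAM2.md` block `[g29]` (this tranche); texts
staged with sha256 under `HOME/pub-arthur-down-g29/primaries/` (`paper:doi-10-1112-s0010437x12000486` = the Compositio PDF text of B112, 41
pp.; corpus TeX `paper:arxiv-1903.11285` (B8, 25 chunks; theorem numbers of the rendering: Thm 1.4 of the introduction = « Theorem 4.2 » =
Theorem (lirmp) of the body), `paper:arxiv-2411.03091` (B57, 18 chunks; TeX macros partly lost), `paper:arxiv-2301.12143` (A5, 52 chunks)).
Loci: B112 p0002:L30-33, p0003:L16-32, L40-41, p0004:L2-3, p0005:L8-13, p0006:L7-11, L21, L35-39, p0019:L9-10, p0034:L12-31, L41-43,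
p0035:L7-9, L21-24, p0039:L37-38, p0040:L32-33, L55-57; B8 p0002:L3-4, p0003:L3, L31-32, L71-98, p0004:L1-3, L53-55, p0009:L57-58,
p0010:L3-9, L63-65, p0011:L3-4, p0012:L3, p0014:L27, p0025:L9, L23, L31, L39, L41; B57 p0002:L3, p0003:L15-19, L29-49, L66, p0004:L1,
p0007:L28-37, L65, L74-78, p0008:L33-37, p0013:L20-23, p0014:L7, p0015:L7, p0016:L7, L9; A5 p0004:L2, L10, L24-32, L37-41, p0047:L63-64, p0052:L15-55. -/

/-- Rows B112 (NEW), B8, B57 of the census and three hypothesis nodes (the LLC for the odd special orthogonal groups of both forms; Ishimoto's Hypothesis 5.2; Gan – Savin's Hypothesis LLC (b), (c)), as an arbitrary assignment of propositions; nothing about the content of a field is assumed. [cite: Arthur2013, downstream register of the cell, fifty-seventh tranche (structure only)] -/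
structure Consumers57 where
  /-- HYPOTHESIS NODE shared by the tranche: « the local Langlands correspondence for SO(V ±) », V⁺ / V⁻ the split / non-split quadratic spaces of discriminant 1 and dimension 2n + 1 over a non-archimedean local field of characteristic 0, all n — the hypothesis of Gan – Savin's Corollary 1.2 (`paper:doi-10-1112-s0010437x12000486` p0003:L21-24 "Corollary 1.2. Assume the local Langlands correspondence for SO(V ± ). Then one obtains a local Langlands correspondence for Mp(W ), i.e. a bijection Lψ : Irr(Mp(W )) ←→ Φ(Mp(W )) (depending on ψ) where Φ(Mp(W )) is the set of pairs (φ, η) such that:" …), restated as a theorem by Ishimoto 2020 §5 (`paper:arxiv-1903.11285` p0010:L3-4 "The local Langlands correspondence for odd special orthogonal groups was established by Arthur [art13] and Mœglin-Renard [mr]. In this section, we summarize some properties of the correspondence and the local intertwining relation." […] p0010:L6-7 "Arthur [art13] and Mœglin-Renard [mr] studied representations of $\SO(V^+)$ and $\SO(V^-)$, respectively. Their results imply LLC of Vogan type for $\SO(V)$:" p0010:L9 "Theorem 5.1." — LLC of Vogan type for SO(V): a surjection Π_temp(SO(V⁺)) ⊔ Π_temp(SO(V⁻)) → Φ_temp(SO_2n+1)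 with finite fibres, unique bijections ι : Π_φ → Irr(π₀(S_φ)) with Π_φ(SO(V^±)) cut out by ι(σ)(z_φ) = ±1, compatibility with parabolic induction) and invoked by W.-W. Li 2026 as p0007:L37 "On the other hand, the LLC for special odd orthogonal groups is known by [Ar13]: it decomposes the right hand side of (eqn:LLC-Mp-Theta) into Vogan L-packets indexed by L-parameters $\mathcalL_F \to (2n, )$. This is how (eqn:LLC-Mp) arises." (for BOTH forms).  The V⁺ half is the book's Theorem 1.5.1 for the split SO_2n+1; the V⁻ half is the book's unwritten Chapter 9 (inner forms), supplied in print by Mœglin – Renard 2018 (row A8-p) per Ishimoto 2020's sentence and by Ishimoto 2024 (row A5, generic parameters, WITH the LIR) per its own — the two supply edges `E_LLCoddSO_of_MR`, `E_oddSOHyps_of_Ishimoto` below.  Gan – Savin's 2012 expectation: p0003:L29-32 "Since the local Langlands correspondence for SO(V ± ) is known for dim V = 5 (from [GT11, GT]), the statement of the corollary is unconditional in this case. The general case should follow by combining the results of the recently released book [Art11] by Arthur and the results of Jiang and Soudry [JS04]." ([GT11, GT] = Gan – Takeda (dim V = 5): Arthur-free). [cite: GanSavin2012MetaplecticI, Cor.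 1.2 (p0003:L21-24), p0003:L29-32; Ishimoto2020LIRMp, Thm 5.1 (p0010:L3-9); LiWenWei2026Variation, §3.2 (p0007:L37) (node; suppliers typed below)] -/
  LLCoddSO : Prop
  /-- HYPOTHESIS NODE (row B8's printed assumption): Ishimoto's Hypothesis 5.2 — the local intertwining relation for SO(V), V = V⁺ or V⁻, tempered parameters, relative to the normalised self-intertwining operators of his §7 (`paper:arxiv-1903.11285` p0010:L63 "The next hypothesis is the local intertwining relation for $\SO(V)$, and it has already been proven in the case $V=V^+$ by Arthur [art13]." p0010:L65 "Hypothesis 5.2." […] p0012:L3 "In this section, we shall define the normalized self-intertwining operators of $\SO(V)$ (following [art13]) and those of $\Mp(W)$, which are used in Theorem (lirmp) and Hypothesis (lirso) above."; p0014:L27 "By [art13], $\calR_Q(w, \sigma_{L, \bfs})$ is holomorphic at $\bfs=0$ if $V=V^+$.").  The V⁺ case is the book's Theorem 2.4.1 (the paper says so); the V⁻ case had no supplier in 2019 (p0004:L10 "We remark that LLC of non-quasi-split odd special orthogonal groups has already studied by Mœglin-Renard [mr], but their result does not contain LIR." — Ishimoto 2024 on [mr]) and is supplied for generic (in particular tempered)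 parameters by Ishimoto 2024 = row A5 per its own sentence (`E_oddSOHyps_of_Ishimoto`). [cite: Ishimoto2020LIRMp, Hypothesis 5.2 (p0010:L63-65), §7 (p0012:L3, p0014:L27); Ishimoto2024, §1 (p0004:L10, L32, L40-41) (node; supplier typed below)] -/
  LIRoddSO : Prop
  /-- HYPOTHESIS NODE (row B112's printed assumptions for Theorem 1.5): Gan – Savin's « Hypothesis LLC » of §12, items (b) and (c) — p0034:L21-22 "(b) Moreover, we suppose that the local Langlands correspondence satisfies the desiderata in [Bor77] and preserves local L-factors and -factors as in Theorem 1.3(vii) and (viii)." / p0034:L23-25 "(c) In addition, for representations π1 and π2 which have the same L-parameter, one has an equality of Plancherel measures µ(s, π1 × ρ, ψ) = µ(s, π2 × ρ, ψ)." — over and above item (a) (p0034:L13-20 "assume that the local Langlands correspondence for SO(V ± ) is known. Hence, let us begin by setting down the precise hypotheses we shall require. Hypothesis LLC. (a) We assume the local Langlands correspondence for the classical groups G = SO2n+1 , SO2n and Sp2n as supplied by the recently released book [Art11] and supplemented by the results of Jiang and Soudry [JS04]. In particular, each irreducible representation of the group G is indexed by a pair (φ, η) consisting of an L-parameter φ for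 the group G and a character η of the component group Aφ ." — typed as the book at all ranks ∧ `LLCoddSO`).  No supplier edge is typed for (b), (c) (the preservation of L- / ε-factors and the constancy of Plancherel measures on L-packets for the LLC of [Art11]: no typed text asserts them; row B57 re-proves Theorem 1.5 for bounded parameters WITHOUT them). [cite: GanSavin2012MetaplecticI, §12 Hypothesis LLC (p0034:L13-27) (node; no supplier)] -/
  GSHypBC : Prop
  /-- B112 (NEW census row; grade G-ii: the hypothesis on the SO(V ±) LLC is printed and the book is « recently released », its role hedged « should follow »): W. T. Gan – G. Savin, *Representations of metaplectic groups I: epsilon dichotomy and local Langlands correspondence*, Compositio Math. 148 (2012) no. 6, 1655–1694, doi:10.1112/S0010437X12000486 (publisher PDF text `paper:doi-10-1112-s0010437x12000486`, 41 pp.; k non-archimedean of characteristic 0, p odd for Theorem 1.1 — the Howe-duality sentence is in the line comment below) — p0002:L30-33 "The purpose of this paper is to investigate the (genuine) representation theory of Mp(W ). More precisely, we shall: • obtain a local Langlands correspondence for Mp(W ) and establish some of its expected properties;" THEOREM 1.1 (Arthur-free, proved in the paper): p0003:L16-20 "Theorem 1.1. For each non-trivial additive character ψ : k → C× , there is a bijection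 Θψ : Irr(Mp(W )) ←→ Irr(SO(V + )) t Irr(SO(V − )) where V + (respectively, V − ) is the split (respectively, non-split) quadratic space of discriminant 1 and dimension 2n + 1. This bijection is given by the theta correspondence (with respect to ψ) for the group Mp(W ) × SO(V ± )." COROLLARY 1.2 (the typed statement, AS STATED under its hypothesis `LLCoddSO`): p0003:L21-24 "Corollary 1.2. Assume the local Langlands correspondence for SO(V ± ). Then one obtains a local Langlands correspondence for Mp(W ), i.e. a bijection Lψ : Irr(Mp(W )) ←→ Φ(Mp(W )) (depending on ψ) where Φ(Mp(W )) is the set of pairs (φ, η) such that:" […] with THEOREM 1.3 (p0003:L40-41 "Theorem 1.3. Suppose that π ∈ Irr(SO(V )) and σ ∈ Irr(Mp(W )) correspond under Θψ . Then the following hold." p0004:L2-3 "(i) π is a discrete series representation if and only if σ is a discrete series representation. (ii) π is tempered if and only if σ is tempered. Moreover, suppose that" […] — the expected properties (i)–(viii): discrete series, temperedness and compatibility with parabolic induction, generic representations, theta dichotomy, L- / ε- / γ-factors, Plancherel measures) and THEOREM 1.4 (epsilon dichotomy; Arthur-free); p0005:L8-9 "It is not difficult to see that the bijection Θψ (or Lψ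 ) is determined by the properties of the above theorem, at least on the level of L-packets. It has also come to our attention that" […] p0005:L12 "It follows from Theorem 1.3(i)–(vi) that our local L-packets agree with" p0005:L13 "Moeglin’s. Since we will not recall her intricate results, we do not elaborate on this point here." ([Moe11b] = row B75's paper). [cite: GanSavin2012MetaplecticI, Thm 1.1 (p0003:L16-20), Cor. 1.2 (p0003:L21-28), Thm 1.3 (p0003:L40–p0005:L3), Thm 1.4 (p0005:L39), p0005:L8-13] -/
  GanSavinLLCMp : Prop
  /-- B112, THEOREM 1.5 = THEOREM 12.1 (the dependence of L_ψ on ψ), stated under `LLCoddSO` AND Hypothesis LLC (a)–(c) of §12: p0006:L7-11 "Finally, we investigate how the local Langlands correspondence Lψ depends on ψ. For this, we shall of course assume the local Langlands correspondence for SO(V ± ) so that Corollary 1.2 makes sense. In addition, we assume that the local Langlands correspondence for SO(V ± ) satisfies certain expected properties in relation to the theory of endoscopy; these are detailed in § 12. To state the result, we" […] p0006:L21 "Theorem 1.5. For σ ∈ Irr(Mp(W )) and c ∈ k × , let" […] p0006:L35 "(ii) The characters η and ηc are related by" p0006:L36 "ηc (ai )/η(ai ) = (1/2, φi ) · (1/2,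 φi ⊗ χc ) · χc (−1)(dim φi )/2 ∈ {±}." […]; §12: p0035:L7-9 "Under Hypothesis LLC and with the above theorems (GP) and (Θ), one has the following result. Theorem 12.1. For σ ∈ Irr(Mp(W )) and c ∈ k × , let Lψ (σ) = (φ, η) and Lψc (σ) = (φc , ηc ). Then" […] p0035:L21-22 "When dim W = 2, this reduces to Waldspurger’s result, Theorem 5.3. The remainder of this paper is devoted to the proof of Theorem 12.1. We first note the following reduction." p0035:L23-24 "Proposition 12.2. If Theorem 12.1 holds for tempered representations of Mp(W ), then it holds for all representations." — (GP) = the local Gross – Prasad statement for tempered representations of special orthogonal groups (Waldspurger 2010–2012; the sentence naming the conj. is in the line comment below), (Θ) = p0034:L40-42 "• (Θ) Consider the theta correspondence for Sp(W ) × O(U ) with dim W = 2n and dim U = 2n + 2 with discriminant χU . For an irreducible tempered representation τ of Sp(W ) which participates in this theta correspondence, it was shown by Muić [Mui08a, Mui08b] that" […] (Muić 2008, Mœglin 2011 [Moe11a]): published, Arthur-free, absorbed. [cite: GanSavin2012MetaplecticI, Thm 1.5 (p0006:L21-36), Thm 12.1 (p0035:L9-20), §12 (p0034:L13–p0035:L8),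 Prop. 12.2 (p0035:L23-24)] -/
  GanSavinPsi : Prop
  /-- B8 (census grade G-i: no sentence on the status of [art13]; the paper's own hypothesis — the LIR for the non-quasi-split SO(V⁻) — IS printed: abstract p0002:L3-4 "In an earlier paper of Wee Teck Gan and Gordan Savin, the local Langlands correspondence for metaplectic groups over a nonarchimedean local fields of characteristic zero was established. In this paper, we formulate and prove a local intertwining relation for metaplectic groups assuming the local intertwining relation for non-quasi-split odd special orthogonal groups."): H. Ishimoto, *Local intertwining relation for metaplectic groups*, Compositio Math. 156 (2020) no. 8, 1560–1594, doi:10.1112/S0010437X20007253 = arXiv:1903.11285 (corpus TeX `paper:arxiv-1903.11285`, 25 chunks; F a p-adic field) — p0003:L95-98 "Although in general the map $\mathit{LL}$ may not be bijective, there is a formula that describes how the bijection $\iota$ classifies the elements in a same packet in terms of intertwining operators. Namely, this formula can distinguish the elements of each packet $\Pi_\phi$ more precisely by means of the eigenvalues of intertwining operators. We call this formula the local intertwining relation. This of course is closely related to the endoscopic character relations." THEOREM 1.4 of the introduction (= Theorem (lirmp), « Theorem 4.2 » of the rendering's body): p0004:L53-55 "Theorem 1.4. Assume the local intertwining relation for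 the odd special orthogonal groups (Hypothesis (lirso) below). Let $\phi \in \Phitemp(M)$ be an $L$-parameter for a Levi subgroup $M$ of a parabolic subgroup $P$ of $\Mp_{2n}(F)$, and $\pi_M \in \Pi_{\phi, \psi}(M)$." […] — for every x ∈ π₀(S_φ(Mp_2n)) the normalised self-intertwining operator R_P(x, π_M) acts on π ⊂ Ind_P(π_M) by the scalar ι_ψ(π)(x); body: p0009:L57-58 "Theorem 4.2. Assume the local intertwining relation for the odd special orthogonal groups (Hypothesis (lirso) below)." […] [cite: Ishimoto2020LIRMp, Thm 1.4 (p0004:L53-55) = Thm 4.2 of the corpus rendering (p0009:L57-58); abstract (p0002:L3-4); p0003:L95-98] -/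
  IshimotoLIRMp : Prop
  /-- B57 (census grade G-i): Wen-Wei Li, *Variation of additive characters in the transfer for Mp(2n)*, Frontiers of Mathematics (2026), doi:10.1007/s11464-024-0193-3 = arXiv:2411.03091 (corpus TeX `paper:arxiv-2411.03091`, 18 chunks, TeX macros partly lost in extraction; F any local field of characteristic 0) — p0002:L3 "Let $Mp(2n)$ be the metaplectic group of rank $n$ over a local field $F$ of characteristic zero. In this note, we determine the behavior of endoscopic transfer for $Mp(2n)$ under variation of additive characters of $F$. The arguments are based on properties of transfer factor, requiring no deeper results from representation theory. Combined with the endoscopic character relations of Luo, this provides a simple and uniform proof of a theorem of Gan--Savin, which describes how the local Langlands correspondence for $Mp(2n)$ depends on the additive characters." THEOREM 1 (the typed statement; Gan – Savin's Theorem 1.5 for BOUNDED L-parameters, all local F of characteristic 0): p0003:L31 "Theorem 1 (= Theorem (prop:GS))." p0003:L32-33 "Given $c \in F^\times$, define the additive character $ _c$ of $F$ by $ _c(x) = (cx)$. For all bounded L-parameter $\phi$ and $ \in _\phi^ $, we have" […] p0003:L39 "- $\delta_c \in _\phi^ $ is explicitly defined in terms of local root numbers and $ (-1)$ (Definition (def:delta-c))."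 — p0003:L41 "The above recovers [GS1]. This statement appeared first as [GGP1]. We shall deduce it from the following result about endoscopic transfer." THEOREM 2 (Arthur-free: p0003:L49 "Theorem 2 (= Theorem (prop:Trans-var))." […] p0003:L45 "The existence of transfer is the main result of [Li11], and the endoscopic character relations are given by its dual (i.e. transpose) $ _ ^!, \tildeG$. Transfer can be defined on the level of $\tildeG^(2)$, and we add an exponent $ $ to indicate its dependence on additive characters."); p0003:L66 "These results are used in [Li24a] to describe certain Arthur packets of $\tildeG$." ([Li24a] = row C28 `Consumers11.LiMpApackets`). [cite: LiWenWei2026Variation, Thm 1 = Thm (prop:GS) (p0003:L31-39), Thm 2 = Thm (prop:Trans-var) (p0003:L49), p0003:L43-45, Thm 6 (p0008:L33-37); abstract (p0002:L3)] -/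
  LiPsiVariation : Prop

variable (ν : Nodes) (μ : Mok2015.Nodes) (κ : KMSW2014.Nodes) (c : Consumers) (c₂ : Consumers2) (c₁₁ : Consumers11)
  (c₁₃ : Consumers13) (c₅₇ : Consumers57)

-- Verbatim, the sentences the docstring lint keeps out of docstrings (each names a conj.) and the bibliography entries.
-- B112 (`paper:doi-10-1112-s0010437x12000486`): p0006:L37-39 "It is interesting to note that the proof of this last theorem makes use of the Gross–Prasad conjecture for tempered representations of special orthogonal groups, which has recently been demonstrated by Waldspurger in a remarkable series of articles [Wal10, Wal12a, Wal1, Wal2]." / §12 p0034:L12 "of this section is to verify that conjecture. Of course, to address the issue, one would need to" p0034:L28-31 "Under the above hypothesis, one has the following highly non-trivial results. • (GP) The Gross–Prasad conjecture [GP92] for tempered representations of special orthogonal groups holds by the recent work of Waldspurger [Wal10, Wal12a, Wal1, Wal2, Wal12b]. More precisely, suppose that π is an irreducible tempered representation of SO(V )" / §6 Remark p0019:L9-10 "Remark. The only reason for assuming odd residue characteristic in Theorem 1.1 and its proof is that Howe’s conjecture for local theta correspondence is only known under this assumption." / bibliography: p0039:L37-38 "J. Arthur, The endoscopic classification of representations: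 orthogonal and symplectic groups, Preprint (2011), available at http://www.claymath.org/cw/arthur/pdf/Book.pdf." / p0040:L32-33 "D. H. Jiang and D. Soudry, Generic representations and local Langlands reciprocity law for p-adic SO2n+1 , in Contributions to automorphic forms, geometry, and number theory (Johns" / p0040:L55-57 "Moe11b C. Moeglin, Multiplicité 1 dans les paquets d’Arthur aux places P -adiques, in On certain L-functions, Clay Mathematics Proceedings, vol. 13 (American Mathematical Society, Providence, RI, 2011), 333–374."
-- B8 (`paper:arxiv-1903.11285`) bibliography: p0025:L9 "[art13] J. Arthur, The endoscopic classification of representations: orthogonal and symplectic groups, American Mathematical Society Colloquium Publications, 61, (2013)." / p0025:L23 "[gs] W. T. Gan and G. Savin, Representations of metaplectic groups I: epsilon dichotomy and local Langlands correspondence, Compos. Math. 148, no. 6, (2012), 1655-1694." / p0025:L39 "[mr] C. Mœglin and D. Renard, Sur les paquets d'Arthur des groupes classiques et unitaires non quasi-déployés, In: Heiermann V., Prasad D. (eds) Relative Aspects in Representation Theory, Langlands Functoriality and Automorphic Forms. Lecture Notes in Mathematics, vol 2221. Springer, Cham., (2018), 341-361." / p0025:L31 "[kmsw] T. Kaletha,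 A. Mínguez, S. W. Shin, P.-J. White, Endoscopic classification of representations: inner forms of unitary groups, arXiv:1409.3731." / p0025:L41 "[mok] C. P. Mok, Endoscopic classification of representations of quasi-split unitary groups, Mem. Amer. Math. Soc. 235, no.1108, (2015)."
-- B57 (`paper:arxiv-2411.03091`): p0003:L17 "For $ (W)$, the LLC and endoscopic transfer both depend on the choices of $ \cdot|\cdot$ and $ $; more precisely, on $ \circ \cdot|\cdot$. The dependence is elucidated completely by [GS1] for non-Archimedean $F$, to be reviewed in Theorem (prop:GS-preview). The proof in loc. cit. is surprisingly roundabout: besides advanced properties of $ $-lifting, it also used the local Gross--Prasad conjecture for special orthogonal groups. On the other hand, the Archimedean case should be contained in [AB98], or follows from similar arguments, but there seems to be no written account." / bibliography (biblatex .bbl entries, first tokens): p0014:L7 "[Ar13] \entry{Ar13}{book}{}" / p0015:L7 "[GS1] \entry{GS1}{article}{}" / p0016:L9 "[Luo20] \entry{Luo20}{article}{}" / p0016:L7 "[Li24a] \entry{Li24a}{misc}{}"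
-- A5 (`paper:arxiv-2301.12143`, the supplier text) bibliography: p0052:L25 "[gs] W. T. Gan and G. Savin, Representations of metaplectic groups I: epsilon dichotomy and local Langlands correspondence, Compos. Math. 148, no. 6, pp.1655-1694, (2012)." / p0052:L33 "[ishi] H. Ishimoto, Local intertwining relation for metaplectic groups, Compos. Math. 156, no. 8, pp.1560-1594, (2020)." / p0052:L55 "[mr] C. Mœglin and D. Renard, Sur les paquets d'Arthur des groupes classiques et unitaires non quasi-déployés, in Relative aspects in representation theory, Langlands functoriality and automorphic forms, Lecture Notes in Mathematics 2221, pp.341-361, Springer, Cham, (2018)." / p0052:L23 "[gi18] W. T. Gan and A. Ichino, The Shimura-Waldspurger correspondence for $\Mp_{2n}$, Ann. Math. (2) 188, no. 3, pp.965-1016, (2018)." / p0052:L15 "[art13] J. Arthur, The endoscopic classification of representations: orthogonal and symplectic groups, American Mathematical Society Colloquium Publications, vol. 61, (2013)."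

/-- SUPPLY EDGE FOR THE NODE `LLCoddSO`, typed from ISHIMOTO 2020's printed supplier sentence (`paper:arxiv-1903.11285` §5): p0010:L3-4 "The local Langlands correspondence for odd special orthogonal groups was established by Arthur [art13] and Mœglin-Renard [mr]. In this section, we summarize some properties of the correspondence and the local intertwining relation." […] p0010:L6-7 "Arthur [art13] and Mœglin-Renard [mr] studied representations of $\SO(V^+)$ and $\SO(V^-)$, respectively. Their results imply LLC of Vogan type for $\SO(V)$:" p0010:L9 "Theorem 5.1." — with §1 p0003:L31-32 "As mentioned above, Arthur [art13] established LLC for quasi-split $\SO_{2n}$, $\SO_{2n+1}$, and $\Sp_{2n}$, which denote even special orthogonal, the odd special orthogonal, and the symplectic groups of rank $n$, respectively. Moreover, Mœglin-Renard [mr] gives a classification of irreducible tempered representations of non-quasi-split odd special orthogonal groups over $p$-adic fields, hence LLC of Vogan type." — [art13] ↦ the book at all ranks (Theorem 1.5.1 for the split SO_2n+1 ↦ `∀ N, ν.Everything N`), [mr] = C. Mœglin – D. Renard, *Sur les paquets d'Arthur des groupes classiques et unitaires non quasi-déployés*, LNM 2221 (2018) = row A8-p ↦ `Consumers13.MRpadicOrth`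 (tranche 13: ⇐ book ∧ `StabInner` ∧ `TaibiInner`).  Ishimoto 2024 (row A5) adds about [mr]: p0004:L10 "We remark that LLC of non-quasi-split odd special orthogonal groups has already studied by Mœglin-Renard [mr], but their result does not contain LIR." — which concerns the node `LIRoddSO`, not this one. [cite: Ishimoto2020LIRMp, §5 (p0010:L3-7), §1 (p0003:L31-32); MoeglinRenard2018, as [mr]; Arthur2013, Thm 1.5.1 as [art13]] -/
def E_LLCoddSO_of_MR : Prop := (∀ N, ν.Everything N) → c₁₃.MRpadicOrth → c₅₇.LLCoddSO

/-- SUPPLY EDGE FOR THE NODES `LLCoddSO` ∧ `LIRoddSO`, typed from ISHIMOTO 2024's printed supplier sentences (row A5, IMRN 2024, `paper:arxiv-2301.12143` §1): p0004:L24 "Adams-Barbasch [ab95,ab98], Adams [ad] (archimedean case), and Gan-Savin [gs] (non-archimedean case) showed that the local theta correspondence gives a canonical bijection" [Π_temp(Mp_2n) ↔ ⊔_V Π_temp(SO(V))] p0004:L30-32 "where $V$ runs over all $(2n+1)$-dimensional quadratic space of discriminant 1 over $F$. Thanks to their results, LLC for $\Mp_{2n}$ is implied by that for all $\SO(V)$.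 In addition, there is an article [ishi] which proved LIR for $\Mp_{2n}$ assuming that for all $\SO(V)$ over a $p$-adic field." […] p0004:L37-38 "AMF for the metaplectic group was studied by Gan-Ichino [gi18]. They proved the decomposition of the discrete spectrum of $\Mp_{2n}$ into near equivalence classes without any assumption, and proved the decomposition into irreducible automorphic representations of the generic part assuming that for all non-quasi-split odd special orthogonal groups." p0004:L40-41 "Those theories will be completed by this paper. Namely, LLC and LIR for the metaplectic groups will hold true, and the result of Gan-Ichino [gi18] on the generic part of AMF will be unconditional." — [gs] = row B112, [ishi] = row B8 (Ishimoto 2020), [gi18] = row C1 (whose Theorem 1.4 `Consumers.GanIchino14` tranche 1 already feeds from A5 through `E_NonsplitOdd_of_Ishimoto`); the supplier is A5's theorem for GENERIC parameters ↦ `Consumers.IshimotoGeneric` (tranche 1: Theorem 1.2's generic part — LLC, ECR, AMF for the non-quasi-split odd special orthogonal groups; ⇐ book ∧ `StabInner`), the LIR for generic parameters being proved on the way (p0004:L2 "The local intertwining relation ( [kmsw], Theorem (2.6.2) in this paper), for which we shall write LIR for short, is a key theorem in the proof of the local main theorems ECR and LLC." […] p0047:L63-64 "Now Theorem (2.6.2)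 holds for any generic parameters. This completes the proof of LIR for generic parameters.") — tempered L-parameters are generic, so Ishimoto 2020's Hypothesis 5.2 (tempered parameters) and the LLC of Vogan type for SO(V⁻) are covered as the sentence says; the V⁺ halves are the book's Theorems 1.5.1 / 2.4.1 ↦ `∀ N, ν.Everything N`. [cite: Ishimoto2024, §1 (p0004:L2, L10, L24-32, L37-41), §6.4 (p0047:L63-64); Ishimoto2020LIRMp, Hypothesis 5.2, as [ishi]; GanSavin2012MetaplecticI, Cor. 1.2, as [gs]] -/
def E_oddSOHyps_of_Ishimoto : Prop := (∀ N, ν.Everything N) → c.IshimotoGeneric → c₅₇.LLCoddSO ∧ c₅₇.LIRoddSO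

/-- B112, COROLLARY 1.2 AS STATED: the LLC for Mp(W) follows from the node « the local Langlands correspondence for SO(V ±) » and the paper's own Theorem 1.1 (`paper:doi-10-1112-s0010437x12000486` p0003:L21-24 "Corollary 1.2. Assume the local Langlands correspondence for SO(V ± ). Then one obtains a local Langlands correspondence for Mp(W ), i.e. a bijection Lψ : Irr(Mp(W )) ←→ Φ(Mp(W )) (depending on ψ) where Φ(Mp(W )) is the set of pairs (φ, η) such that:" …) — Theorem 1.1's inputs (Howe duality for p odd, Kudla – Rallis [KR05], the doubling ε-factor of Lapid – Rallis, [GGP12]'s sketch, [GI] = Gan – Ichino Invent. Math. 2014 for Thm 1.3 (iv)) are published and Arthur-free, absorbed; the SO(V⁺) half of the hypothesis, which the authors expect from « [Art11] … and … [JS04] », enters through the node and its supply edges, not as a premise of this edge (pattern of rows B3 / B12 / C15).  The edge has NO DAG premise. [cite: GanSavin2012MetaplecticI, Cor. 1.2 with Thm 1.1 (p0003:L14-32), §6 (p0019:L7-10)] -/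
def E_GanSavinLLCMp : Prop := c₅₇.LLCoddSO → c₅₇.GanSavinLLCMp

/-- B112, THEOREM 1.5 = THEOREM 12.1 (`paper:doi-10-1112-s0010437x12000486`): p0006:L7-11 "Finally, we investigate how the local Langlands correspondence Lψ depends on ψ. For this, we shall of course assume the local Langlands correspondence for SO(V ± ) so that Corollary 1.2 makes sense. In addition, we assume that the local Langlands correspondence for SO(V ± ) satisfies certain expected properties in relation to the theory of endoscopy; these are detailed in § 12. To state the result, we" […] §12 p0034:L13-20 "assume that the local Langlands correspondence for SO(V ± ) is known. Hence, let us begin by setting down the precise hypotheses we shall require. Hypothesis LLC. (a) We assume the local Langlands correspondence for the classical groups G = SO2n+1 , SO2n and Sp2n as supplied by the recently released book [Art11] and supplemented by the results of Jiang and Soudry [JS04]. In particular, each irreducible representation of the group G is indexed by a pair (φ, η) consisting of an L-parameter φ for the group G and a character η of the component group Aφ ." — item (a) ↦ the book at all ranks (`∀ N, ν.Everything N`: the LLC for the split SO_2n+1, SO_2n, Sp_2n « as supplied by the recently released book [Art11] »; [JS04] = Jiang – Soudry (generic representations of SO_2n+1): published, Arthur-free, absorbed) ∧ the node `LLCoddSO`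 (the SO(V⁻) half, which Corollary 1.2 — hence L_ψ itself — needs); items (b), (c) ↦ the node `GSHypBC`; (GP) (Waldspurger) and (Θ) (Muić, Mœglin) published and Arthur-free, absorbed; p0035:L7-9 "Under Hypothesis LLC and with the above theorems (GP) and (Θ), one has the following result. Theorem 12.1. For σ ∈ Irr(Mp(W )) and c ∈ k × , let Lψ (σ) = (φ, η) and Lψc (σ) = (φc , ηc ). Then" […].  Premises: the book (all ranks), `LLCoddSO`, `GSHypBC`. [cite: GanSavin2012MetaplecticI, Thm 1.5 (p0006:L7-36), §12 Hypothesis LLC (p0034:L13-27), (GP)/(Θ) (p0034:L28–p0035:L6), Thm 12.1 (p0035:L7-20); Arthur2013, as [Art11]] -/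
def E_GanSavinPsi : Prop := (∀ N, ν.Everything N) → c₅₇.LLCoddSO → c₅₇.GSHypBC → c₅₇.GanSavinPsi

/-- B8, THEOREM 1.4 (`paper:arxiv-1903.11285`): THE INPUTS — p0003:L3 "In his long-awaited book [art13], Arthur obtained a classification of irreducible representations of quasi-split symplectic and special orthogonal groups over local fields of characteristic zero (the local Langlands correspondence, which we shall call LLC for short)." […] p0004:L1-3 "In [art13], Arthur proved the local intertwining relation for quasi-split special orthogonal and symplectic groups ( [art13]). Mok [mok] and Kaletha-Mínguez-Shin-White [kmsw] proved for inner forms of unitary groups. Our aim in this paper is to formulate and prove a local intertwining relation for $\Mp_{2n}(F)$ under the assumption that the local intertwining relation for the non-quasi-split odd special orthogonal groups holds." — [art13] ↦ the book at all ranks (the LLC for SO(V⁺) = SO_2n+1 split, Theorem 1.5.1; the LIR for V = V⁺, Theorem 2.4.1: p0010:L63 "The next hypothesis is the local intertwining relation for $\SO(V)$, and it has already been proven in the case $V=V^+$ by Arthur [art13]." p0010:L65 "Hypothesis 5.2." […]; the normalised operators of §7 « following [art13] »); the LLC of Vogan type for SO(V) (Theorem 5.1, « Arthur [art13] and Mœglin-Renard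 [mr] ») ↦ the node `LLCoddSO` (its own supply edges carry [mr]); the LIR for SO(V⁻) ↦ the node `LIRoddSO` (Hypothesis 5.2, the theorem's only printed assumption); Gan – Savin: p0003:L71-73 "Let $\Pitemp(\Mp_{2n})$ be the set of equivalence classes of irreducible genuine tempered admissible representations of $\Mp_{2n}(F)$, and put $\Phitemp(\Mp_{2n})=\Phitemp(\SO_{2n+1})$. Fix a nontrivial additive character $\psi : F \to \C^1$. We have LLC for $\Mp_{2n}(F)$ depending on the choice of $\psi$, due to Gan-Savin [gs]:" p0003:L75 "Theorem 1.3." […] p0003:L87 "* For each $\phi \in \Phitemp(\Mp_{2n})$, there exists a unique bijective map" […] p0003:L93 "which depends on the choice of $\psi$, and this map satisfies some nice properties." and §6 p0011:L3-4 "Gan-Savin [gs] showed the local Shimura correspondence, which is the natural bijection between the set of isomorphism classes of irreducible genuine representations of $\Mp(W)$ and the set of isomorphism classes of irreducible representations of $\SO(V^+)$ and $\SO(V^-)$. This is given by the local theta correspondence, and we can construct LLC for $\Mp(W)$ (Theorem (llcmp)), by combining the local Shimura correspondence with LLC for $\SO(V)$ of Vogan type (Theorem (llcso))." ↦ `GanSavinLLCMp`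 (row B112; the local Shimura correspondence itself, Theorem 6.1 = [gs] Theorem 1.1, is Arthur-free); [mok], [kmsw] context only (the unitary LIR); [gifd], [gigp] = Gan – Ichino 2014 / 2016 (theta-analytic inputs): published, absorbed.  Premises: the book (all ranks), `LLCoddSO`, `LIRoddSO`, `GanSavinLLCMp`. [cite: Ishimoto2020LIRMp, Thm 1.4 (p0004:L53-55) with §1 (p0003:L3, L31-32, L71-93, p0004:L1-3), §5 Thm 5.1 / Hypothesis 5.2 (p0010:L3-65), §6 (p0011:L3-4), §7 (p0012:L3, p0014:L27); Arthur2013, Thms 1.5.1, 2.4.1 as [art13]; GanSavin2012MetaplecticI, as [gs]] -/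
def E_IshimotoLIRMp : Prop :=
  (∀ N, ν.Everything N) → c₅₇.LLCoddSO → c₅₇.LIRoddSO → c₅₇.GanSavinLLCMp → c₅₇.IshimotoLIRMp

/-- B57, THEOREM 1 ⇐ THE BOOK ∧ LUO'S CHARACTER IDENTITIES (B11) ∧ GAN – SAVIN'S LLC (B112) (`paper:arxiv-2411.03091`): p0003:L15 "Later on, based on endoscopy for metaplectic groups [Li11] and the global multiplicity formula of Gan--Ichino [GI18], C. Luo [Luo20] proved the endoscopic character relations for $ (W)$ and characterized the correspondences above in terms of endoscopic transfer." […] p0003:L19 "The aim of this note is to offer a direct endoscopic proof of the aforementioned result, which applies uniformly to all $F$. Given Luo's character relations, we will deduce it from a variation formula for the endoscopic transfer for orbital integrals." — p0004:L1 "Luo's character relation is applied to deduce Theorem (prop:GS-preview) from Theorem (prop:Trans-var-preview), as performed in [Li24a]. Luo's proof does not involve [GS1], and neither does [GI18], so there is no worry of circularity." THE OBJECTS: p0003:L29 "For all $ \in _\phi^ $, the LLC in [GS1] gives a tempered genuine irreducible representation $\pi_\phi, $ of $\tildeG$. An exponent $ $ indicates its dependence on additive characters." ↦ `GanSavinLLCMp`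 (row B112: the LLC of [GS1] = Corollary 1.2; how it arises: p0007:L30 "The correspondence (eqn:LLC-Mp) is established in [AB98] for $F = $, and [GS1] for non-Archimedean $F$." […] p0007:L37 "On the other hand, the LLC for special odd orthogonal groups is known by [Ar13]: it decomposes the right hand side of (eqn:LLC-Mp-Theta) into Vogan L-packets indexed by L-parameters $\mathcalL_F \to (2n, )$. This is how (eqn:LLC-Mp) arises." — the theta bijection is [GS1]'s Theorem 1.1, Arthur-free; « the LLC for special odd orthogonal groups … known by [Ar13] » for BOTH forms SO(V ±) is, in the register's vocabulary, the book (V⁺, Theorem 1.5.1) and the node `LLCoddSO` (V⁻: not in the book — B-Ch9), both reached through `GanSavinLLCMp`'s own edge); THE ENDOSCOPIC INPUTS: p0007:L65 "- $S ^G^!_\phi^!$ is the stable tempered character on $G^!(F)$ attached to $\phi^!$ by Arthur's theory [Ar13], which is independent of Whittaker data since $G^!$ is adjoint." ↦ the book at all ranks (`∀ N, ν.Everything N`: the stable tempered characters of the split SO(2n′+1) × SO(2n″+1), Theorems 1.5.1 / 2.2.1); p0007:L74-75 "Theorem 4 (C. Luo [Luo20]). Let $\phi \in _bdd(\tildeG)$.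 The representations $\pi_\phi, $ (where $ \in _\phi^ $) are characterized by the following identities: for every $x \in _\phi$ we have" […] p0007:L78 "This gives another characterization of the LLC of $\tildeG$ that is based on endoscopic transfer." ↦ `Consumers11.LuoECR` (row B11, tranche 11: ⇐ book); the proof: p0013:L20 "On the other hand, Luo's Theorem (prop:Luo-endo) implies that $^ \pi^ _\phi, = (\pi^ _\phi, )$, and ditto for $^ \pi^ _c_\phi , \delta_c$. This concludes the proof." […] p0013:L23 "The arguments above rely on Luo's work [Luo20], which in turn is based on the Gan--Ichino multiplicity formula [GI18]. None of these references depend on [GS1], so there is no circularity here." ([GI18] = row C1; context).  The transfer [Li11] and its variation formula (Theorem 2), [Li24a] = row C28 (where the deduction « as performed » first appeared; C28's typed field is not a premise — Theorem 1 is proved in full in §5 here), [AB98] / [GGP1] (archimedean case, first statement): published or the author's own, absorbed.  Premises: the book (all ranks), `LuoECR`, `GanSavinLLCMp`. [cite: LiWenWei2026Variation, Thm 1 (p0003:L31-39) with §1 (p0003:L15-19, L29, L41, p0004:L1), §3.2 (p0007:L28-37), §3 (p0007:L65, L74-78), §5 (p0013:L20-23); Luo2020Metaplectic, Main Theorem,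 as [Luo20]; GanSavin2012MetaplecticI, Cor. 1.2 / Thm 1.5, as [GS1]; Arthur2013, as [Ar13]] -/
def E_LiPsiVariation : Prop := (∀ N, ν.Everything N) → c₁₁.LuoECR → c₅₇.GanSavinLLCMp → c₅₇.LiPsiVariation

/-- The fifty-seventh tranche of implications: two supply edges for the nodes `LLCoddSO` / `LIRoddSO` (Ishimoto 2020 §5, Ishimoto 2024 §1), B112's two edges, B8's, B57's (the node `GSHypBC` has no supplier). [cite: GanSavin2012MetaplecticI, Cor. 1.2, Thm 1.5; Ishimoto2020LIRMp, Thm 1.4, §5; Ishimoto2024, §1; LiWenWei2026Variation, Thm 1 (each edge's source in its own docstring)] -/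
structure Implications57 : Prop where
  ofMR : E_LLCoddSO_of_MR ν c₁₃ c₅₇
  ofIshimoto : E_oddSOHyps_of_Ishimoto ν c c₅₇
  gsLLC : E_GanSavinLLCMp c₅₇
  gsPsi : E_GanSavinPsi ν c₅₇
  ishimotoLIR : E_IshimotoLIRMp ν c₅₇
  liPsi : E_LiPsiVariation ν c₁₁ c₅₇

variable {ν μ κ c c₂ c₁₁ c₁₃ c₅₇}

/-- B112, COROLLARY 1.2 FROM ITS HYPOTHESIS, as stated. [cite: GanSavin2012MetaplecticI, Cor. 1.2 (bookkeeping proved here)] -/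
theorem ganSavinLLCMp_of_hypothesis (W : Implications57 ν c c₁₁ c₁₃ c₅₇) (h : c₅₇.LLCoddSO) : c₅₇.GanSavinLLCMp :=
  W.gsLLC h

/-- THE TWO ODD-ORTHOGONAL NODES FROM THE BOOK'S INPUTS, through Ishimoto 2024's supplier sentence and tranche 1's edges
(A5 ⇐ book ∧ `StabInner` ⇐ the book's published leaves and the general weighted FL): « the LLC for SO(V ±) » and Ishimoto
2020's Hypothesis 5.2 rest on the book's 24 leaves. [cite: Ishimoto2024, §1 (p0004:L40-41); Ishimoto2020LIRMp, Hypothesis 5.2 (bookkeeping proved here)] -/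
theorem oddSOHyps_of_inputs (W : Implications57 ν c c₁₁ c₁₃ c₅₇) (I : Implications ν μ κ c) (A : BookInputs ν) :
    c₅₇.LLCoddSO ∧ c₅₇.LIRoddSO :=
  W.ofIshimoto A.everything (ishimotoGeneric_of_leaves I A)

/-- THE NODE `LLCoddSO` BY THE 2018 ROUTE: from the book's inputs and Mœglin – Renard's typed statement (row A8-p), through
Ishimoto 2020's supplier sentence. [cite: Ishimoto2020LIRMp, §5 (p0010:L3-7); MoeglinRenard2018, §3.1 (bookkeeping proved here)] -/
theorem llcOddSO_of_MR (W : Implications57 ν c c₁₁ c₁₃ c₅₇) (A : BookInputs ν) (hMR : c₁₃.MRpadicOrth) : c₅₇.LLCoddSO :=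
  W.ofMR A.everything hMR

/-- THE TRANCHE FROM ITS INPUTS: with the supply edges, tranche 1's edges (A5) and tranche 11's (B11 Luo ⇐ book), all four
statements follow from `BookInputs` and the one unsupplied node `GSHypBC` — which only Gan – Savin's Theorem 1.5 uses. [cite: GanSavin2012MetaplecticI, Cor. 1.2, Thm 1.5; Ishimoto2020LIRMp, Thm 1.4; LiWenWei2026Variation, Thm 1 (bookkeeping proved here)] -/
theorem metaplecticII_of_inputs (W : Implications57 ν c c₁₁ c₁₃ c₅₇) (I : Implications ν μ κ c) (E : Implications11 ν c c₂ c₁₁)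
    (A : BookInputs ν) (hBC : c₅₇.GSHypBC) :
    c₅₇.GanSavinLLCMp ∧ c₅₇.GanSavinPsi ∧ c₅₇.IshimotoLIRMp ∧ c₅₇.LiPsiVariation :=
  have b := A.everything
  have h := oddSOHyps_of_inputs W I A
  have gs := W.gsLLC h.1
  ⟨gs, W.gsPsi b h.1 hBC, W.ishimotoLIR b h.1 h.2 gs, W.liPsi b (luoECR_of_leaves E A) gs⟩

/-- THE ψ-VARIATION THEOREM BY TWO ROUTES: Gan – Savin's (2012) needs the node `GSHypBC` over the book's inputs, W.-W. Li's (2026)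
does not. [cite: GanSavin2012MetaplecticI, Thm 1.5 with §12; LiWenWei2026Variation, Thm 1 with p0003:L17-19 (bookkeeping proved here)] -/
theorem psiVariation_two_routes (W : Implications57 ν c c₁₁ c₁₃ c₅₇) (I : Implications ν μ κ c) (E : Implications11 ν c c₂ c₁₁)
    (A : BookInputs ν) : (c₅₇.GSHypBC → c₅₇.GanSavinPsi) ∧ c₅₇.LiPsiVariation :=
  have b := A.everything
  have h := oddSOHyps_of_inputs W I A
  ⟨fun hBC => W.gsPsi b h.1 hBC, W.liPsi b (luoECR_of_leaves E A) (W.gsLLC h.1)⟩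

/-- THE TRANCHE IN CONDITIONAL FORM, 2026: granting the book's edges, its supply edges and every PUBLISHED input, tranche 1's and
tranche 11's edges, the four statements follow from the book's seven 2024–2026 PREPRINT leaves, its two UNWRITTEN weighted lemmas,
and — Gan – Savin's Theorem 1.5 only — the node `GSHypBC`.  Gan – Savin and Ishimoto 2020 print their hypotheses (the SO(V ±)
LLC; the SO(V⁻) intertwining relation), which the register's later suppliers discharge ⇐ the book; W.-W. Li prints none. [cite: GanSavin2012MetaplecticI, p0003:L21, L29-32; Ishimoto2020LIRMp, p0002:L4; LiWenWei2026Variation, p0007:L37 (bookkeeping proved here)] -/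
theorem metaplecticII_conditional_form (W : Implications57 ν c c₁₁ c₁₃ c₅₇) (I : Implications ν μ κ c)
    (E : Implications11 ν c c₂ c₁₁) (B : ν.BookEdges) (S : ν.SupplyEdges) (P : ν.PublishedLeaves) :
    ν.PreprintLeaves2026 → ν.UnwrittenLeaves →
      c₅₇.LLCoddSO ∧ c₅₇.LIRoddSO ∧ c₅₇.GanSavinLLCMp ∧ (c₅₇.GSHypBC → c₅₇.GanSavinPsi) ∧ c₅₇.IshimotoLIRMp ∧
        c₅₇.LiPsiVariation :=
  fun Q U =>
    have A : BookInputs ν := ⟨B, S, P, Q, U⟩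
    have h := oddSOHyps_of_inputs W I A
    have two := psiVariation_two_routes W I E A
    have gs := W.gsLLC h.1
    ⟨h.1, h.2, gs, two.1, W.ishimotoLIR A.everything h.1 h.2 gs, two.2⟩

/-! ## Fifty-eighth tranche (v4, unit `pub-arthur-down-g29`): THE METAPLECTIC LINE, III — GLOBAL CONSUMERS OF GAN – ICHINO (C77 `WuMpChiB`,
C39 `IshimotoIbukiyama`, C121 `IshimotoIbukiyamaDS`) AND THE NEW BOOK ROW C201 `GanWangPeriod`

Context (`DOWNSTREAM.md` rows C39 l.193 `[g2]` (G-i), C77 l.287 `[g3]` (G-ii), C121 l.439 `[g5b]` (G-i) — never typed; `DOWNSTREAM2.md`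
l.633 row C201 `[g46-up]` (PROVISIONAL id from the upstream seat's zbMATH sweep, G-UP-506; CONFIRMED here as C201 — no other C201 exists);
typed premises reused: `Consumers.GanIchino11` (row C1 Thm 1.1, tranche 1), `Consumers5.GanIchinoMp4` (row C2 Thm 2.1, tranche 5: ⇐ book ∧
C1's two theorems); `DOWNSTREAM2.md` block `[g29b]` (this tranche); texts staged with sha256 under `HOME/pub-arthur-down-g29/primaries/`
(corpus TeX `paper:arxiv-2002.08551` (C77, 24 chunks), `paper:arxiv-2010.08736` (C39, 29 chunks), arXiv PDF text `paper:arxiv-2312.06921` (C121,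
v2 of 18 Dec 2023, 72 pp.), corpus TeX `paper:arxiv-2401.06624` (C201, 14 chunks, TeX macros partly lost)).  Loci: C77 p0003:L3-14, L47-59,
p0004:L2, L14, p0008:L3-5, L61-66, p0023:L17-22, L50-52, L139-142, L182-185; C39 p0002:L3, p0003:L15, L19-20, L34-35, L49-50, L59-64,
L74-77, L85, p0004:L30-32, L42, p0009:L3, p0010:L13, L20, L59-62, L80-81, p0029:L13, L23, L25; C121 p0001:L26-28, p0002:L1-2, L52-53,
p0003:L17, L46-50, p0050:L41-46, p0051:L9-10, L37, p0054:L4, p0060:L37-39, L60, p0062:L14-15, p0067:L45, p0071:L54-55, p0072:L1-4,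
L22-23; C201 p0002:L3, p0006:L28, p0013:L3, L7-12, L26, L55-57, p0014:L3, L23. -/

/-- Rows C77, C39, C121, C201 of the census, as an arbitrary assignment of propositions; nothing about the content of a field is assumed. [cite: Arthur2013, downstream register of the cell, fifty-eighth tranche (structure only)] -/
structure Consumers58 where
  /-- C77 (census grade G-ii): Chenyan Wu, *Periods and (χ,b)-factors of cuspidal automorphic forms of metaplectic groups*, J. Number Theory 241 (2022) 262–296, doi:10.1016/j.jnt.2022.03.010 = arXiv:2002.08551 (corpus TeX `paper:arxiv-2002.08551`, 24 chunks; F a number field, σ a genuine cuspidal automorphic representation of Mp_2n(𝔸) = the paper's G̃(X), χ a quadratic character) — p0003:L47 "We now describe our main results which are concerned with the metaplectic case, while pointing out the similarity to the statements in the symplectic case." THEOREM 1 = Thm. (thm:chi-b-factor-LO) p0003:L55-57 "Theorem 1 (Thm. (thm:chi-b-factor-LO)). Let $\sigma\in\cA_\cusp (\til {G} (X))$ and $\chi$ be a quadratic automorphic character of $\AA^\times$. Let $\phi_\psi (\sigma)$ denote the A-parameter of $\sigma$ with respect to $\psi$. Then the following hold." p0003:L59 "* If $\phi_\psi (\sigma)$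 has a $(\chi,b)$-factor, then $b\le \half\dim X +1$." […] (bounds on b for the (χ,b)-factors of φ_ψ(σ) in terms of the lowest occurrence LO_{ψ,χ}(σ)); THEOREM 3 = Thm. (thm:strengthend-eis-pole-2-LO) p0004:L14 "Theorem 3 (Thm. (thm:strengthend-eis-pole-2-LO))." […] (the maximal positive pole of the Eisenstein series vs the lowest occurrence); Theorems 5–6 (first occurrence, non-vanishing of periods).  The object φ_ψ(σ) is Gan – Ichino's: §2 p0008:L3-5 "We recall the description of $A$-parameters attached to genuine irreducible cuspidal automorphic representations of metaplectic groups from [MR3866889]. The $A$-parameters are defined via those attached to irreducible automorphic representations of odd special orthogonal groups via Shimura–Waldspurger correspondence. In this section, we write $\Mp_{2n}$ rather than $\til {G} (X)$." [cite: Wu2022MpChiB, Thm 1 (p0003:L55-59), Thm 3 (p0004:L14), §2 (p0008:L3-5); p0003:L47] -/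
  WuMpChiB : Prop
  /-- C39 (census grade G-i): H. Ishimoto, *Proofs of Ibukiyama's conj.s on Siegel modular forms of half-integral weight and of degree 2* (title word abbreviated; exact title in the line comment below), Math. Ann. 383 (2022) no. 1-2, 645–698 (online 2021), doi:10.1007/s00208-021-02232-4 = arXiv:2010.08736 (corpus TeX `paper:arxiv-2010.08736`, 29 chunks; base field ℚ, level one) — THEOREMS 1.1–1.3 (Ibukiyama's three statements: a Shimura-type isomorphism on the Neben type, a lifting, a Shimura-type isomorphism on the Haupt type — linear maps between spaces of vector-valued Siegel modular forms of degree 2 of half-integral weight and of integral weight preserving L-functions): p0003:L19-20 "Theorem 1.1 ([ibuconj]). For any natural number $k\geq3$ and any even integer $j\geq0$, there is a linear isomorphism" […] p0003:L34-35 "Theorem 1.2 ( [iburef]). For any integer $k\geq0$ and any even integer $j\geq0$, there exists an injective linear map" […] p0003:L49-50 "Theorem 1.3 ( [iburef]). For any integer $k\geq3$ and any even integer $j\geq0$, there exists a linear isomorphism" […] [cite: Ishimoto2022Ibukiyama, Thms 1.1–1.3 (p0003:L19-57)] -/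
  IshimotoIbukiyama : Prop
  /-- C121 (census grade G-i; PREPRINT, arXiv v2 of 18 Dec 2023): H. Ishimoto, *Ibukiyama correspondences on automorphic forms on Mp_4(𝔸_ℚ) and SO_5(𝔸_ℚ) generating large discrete series representations at the real place*, arXiv:2312.06921 (arXiv PDF text `paper:arxiv-2312.06921`, 72 pp.) — THEOREMS 1.1–1.7 = Thms 4.1–4.3, 6.1 (linear isomorphisms / injections, preserving L-functions, between spaces of automorphic forms on Mp_4(𝔸_ℚ) and on SO_5(𝔸_ℚ) generating large discrete series representations at ∞, generalising C39's modular-form statements): p0002:L1-2 "Theorem 1.1 (Shimura type isomorphism on the Neben type) . For any integer k ≥ 3 and any even integer j ≥ 0, there is a linear isomorphism" […] p0002:L52-53 "Theorem 1.4 (Theorem 4.1) . For any integer k ≥ 3 and any odd integer j ≥ 1, there exists a linear isomorphism" […] p0003:L17 "Theorem 1.7 (Theorem 6.1). For any integers k ≥ 3 and j ≥ 0, there exists a linear isomorphism" […] p0003:L46-50 "Then in Section 4, main theorems are stated. The family of these theorems is the first main result of this paper. After that, we give the definition of Adeta Symb (SO5)unr in Section 5. Then in Section 6, the second main theorem is stated.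 In Section 7, we review the multiplicity formulas for split odd special orthogonal group and metaplectic group of degree 2. The multiplicity formulas play key roles. We give proofs of the main theorems in Section 8. The idea of the proofs is similar to that of [16]. In Section 9 we describe theorems in" [cite: Ishimoto2023IbukiyamaDS, Thms 1.1–1.7 (p0002:L1–p0003:L25) = Thms 4.1–4.3 (p0037:L23–p0038:L4), 6.1 (p0049:L32); §8.4 (p0067:L45)] -/
  IshimotoIbukiyamaDS : Prop
  /-- C201 (NEW census row, id CONFIRMED — handed over by the upstream seat up-g46, `DOWNSTREAM2.md` l.633; grade G-i): W. T. Gan – B. P. J. Wang, *Generalised Whittaker models as instances of relative Langlands duality II: Plancherel density and global periods*, Adv. Math. 494 (2026) Paper No. 110933, doi:10.1016/j.aim.2026.110933 = arXiv:2401.06624 (corpus TeX `paper:arxiv-2401.06624`, 14 chunks, TeX macros partly lost; p0006:L28 "We will use all the notation and set-up of [W], specialised to the case of the dual pair $(G,G')$, with $G'= _2a$ the isometry group of a $2a$-dimensional symplectic space $V'$, and $G= _2k$ the isometry group of a $2k$-dimensional orthogonal space $V$ which we assume to be the direct sum of $k$ hyperbolic planes." — G′ = Sp_2a, G = the split O_2k)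 — THEOREM 6.1, AS STATED under its printed hypotheses [LM] (Lapid – Mao's Whittaker-period conj. for Sp_2a, J. Number Theory 146 (2015)) and a local multiplicity one: p0013:L7-8 "Theorem 6.1. Assume [LM], and that one has local multiplicity one for $LU, _\gamma G$ (this is the less serious hypothesis)." p0013:L10 "Let $\Sigma$ be a globally $\psi$-generic cuspidal automorphic representation of $G'= _2a$ with corresponding Langlands parameter $\phi$, and with global theta lift $ := (\Sigma)$ to $G$ which is cuspidal. Suppose further that $ ( )$ is isomorphic to $\Sigma$ (this is the case if $ ( )$ is cuspidal, for instance)." […] p0013:L12 "Let $T$ be a finite set of places (including the Archimedean ones) outside which all data are unramified. Then the restriction of the functional $P_\gamma$ to $ (\Sigma)$ factorises as \[ |P_\gamma(f)|^2 = \frac1|S_\phi| \frac\Delta_G^T(1)\Delta_L^T(1)^2 \frac _i L^T(i/2, \Sigma, V_X^(i))L^T(1, \Sigma, ) _v\in T |l'_ _v (f_v)|^2 \]" […] (the factorisation of the generalised Whittaker period |P_γ(f)|² of the cuspidal global theta lift Θ(Σ) into L-values and local Plancherel functionals); the local results of §§3–5 (the Plancherel density of [BZSV]'s numerical conj.) do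 not cite [Ar] and are not part of this field.  The sentences naming the conj.s of [BZSV] / [LM] are in the line comment below. [cite: GanWang2026WhittakerII, Thm 6.1 (p0013:L7-13); §2.2 (p0006:L28)] -/
  GanWangPeriod : Prop

variable (ν : Nodes) (μ : Mok2015.Nodes) (κ : KMSW2014.Nodes) (c : Consumers) (c₂ : Consumers2) (c₅ : Consumers5)
  (c₅₈ : Consumers58)

-- Verbatim, the sentences and titles the docstring lint keeps out of docstrings (each names a conj.) and the bibliography entries.
-- C77 (`paper:arxiv-2002.08551`), Remark 2: p0004:L2 "Coupled with the results of [MR3805648], we see that in both the $\Sp$ and $\Mp$ cases, if $\phi (\sigma)$ has a $(\chi,b)$-factor with $b$ maximal among all simple factors, then $\LO_{\chi,\psi} (\sigma) \le \dim X - b +1$." / bibliography: p0023:L17-22 "[MR3135650] James Arthur. The endoscopic classification of representations, volume 61 of American Mathematical Society Colloquium Publications. American Mathematical Society, Providence, RI, 2013. Orthogonal and symplectic groups." / p0023:L50-52 "[MR3866889] Wee Teck Gan and Atsushi Ichino. The Shimura-Waldspurger correspondence for ${\rm Mp}_{2n}$." / p0023:L182-185 "[MR3338302] Chung Pang Mok.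 Endoscopic classification of representations of quasi-split unitary groups." / p0023:L139-142 "[kaletha:_endos_class_repres] Tasho Kaletha, Alberto Minguez, Sug Woo Shin, and Paul-James White. Endoscopic classification of representations: Inner forms of unitary groups."
-- C39 (`paper:arxiv-2010.08736`), title « Proofs of Ibukiyama's conjectures on Siegel modular forms of half-integral weight and of degree 2 »; abstract p0002:L3 "We prove Ibukiyama's conjectures on Siegel modular forms of half-integral weight and of degree 2 by using Arthur's multiplicity formula on the split odd special orthogonal group $\SO_5$ and Gan-Ichino's multiplicity formula on the metaplectic group $\Mp_4$." / p0003:L15 "Our aim in this paper is to prove Ibukiyama's conjectures by using Gan-Ichino's multiplicity formula." / p0003:L59 "In order to prove Ibukiyama's conjectures, we will apply the multiplicity formulae of Arthur and Gan-Ichino, and the representation theory of the Jacobi groups." / p0003:L75 "Note that thus the decomposition (gi) is still conjecture in general." / bibliography: p0029:L13 "[art] J. Arthur, The endoscopic classification of representations: orthogonal and symplectic groups, American Mathematical Society Colloquium Publications, 61, (2013)." / p0029:L23 "[gi18] W. T. Gan, A. Ichino, The Shimura–Waldspurger correspondence for $\Mp_{2n}$, Ann. Math. (2) 188, no. 3,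 pp. 965–1016, (2018)." / p0029:L25 "[gi20] W. T. Gan, A. Ichino, The automorphic discrete spectrum of $\Mp_4$, Int. Math. Res. Not., rnaa 121, (2020)."
-- C121 (`paper:arxiv-2312.06921`): p0001:L26-28 "In 2008 and 2014, Ibukiyama [14, 15] proposed the following conjectures on vector valued holomorphic Siegel modular forms of degree 2 of half-integral weight and integral weight. By using the Arthur classification for Mp4 ([7]) and SO 5 ([4]), the conjectures have been proved ([16])." / bibliography: p0071:L54-55 "[4] J. Arthur, The endoscopic classification of representations: orthogonal and symplectic groups , American Mathematical Society Colloquium Publications, 61, (2013)." / p0072:L1-2 "[6] W. T. Gan, A. Ichino, The Shimura–Waldspurger correspondence for Mp2n, Ann. Math. (2) 188, no. 3, pp. 965–1016, (2018)." / p0072:L3-4 "[7] W. T. Gan, A. Ichino, The automorphic discrete spectrum of Mp4, Int. Math. Res. Not., rnaa 121, (2020)." / p0072:L22-23 "[16] H. Ishimoto, Proofs of Ibukiyama’s conjectures on Siegel modular forms of half-integral weight and of degree 2, Math. Ann. 383, pp. 645-698 (2022)."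
-- C201 (`paper:arxiv-2401.06624`): abstract p0002:L3 "In an earlier paper of the authors, a general family of instances of the relative Langlands duality of Ben-Zvi$-$Sakellaridis$-$Venkatesh [BZSV] were proposed and studied in the setting of branching problems for smooth representations. In this paper, we show the numerical conjectures of [BZSV] for the local Plancherel density, as well as an application to their conjectures on global periods, for this general family of instances." / §6 p0013:L3 "The global period conjecture, at least as stated in the case when the (Arthur) $ _2$-type of the automorphic form (for the $M_2$-period) coincides with that of $M_1$ [BZSV], can now be verified in exactly the same way as in [GW2], conditional on the corresponding conjecture for the Whittaker period on general symplectic groups $G'= _2a$ [LM]." / bibliography: p0014:L3 "[Ar] J. Arthur, The endoscopic classification of representations: Orthogonal and symplectic groups, volume 61 of American Mathematical Society Colloquium Publications, American Mathematical Society, Providence, RI, 2013." / p0014:L23 "[LM] E. Lapid, Z.Y. Mao, A conjecture on Whittaker-Fourier coefficients of cusp forms, J. Number Theory 146 (2015), 448-505."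

/-- C77 ⇐ C1 (SECOND ORDER) (`paper:arxiv-2002.08551`).  THE FRAME: p0003:L5-8 "representations. By the theory of endoscopic classification developed by [MR3135650] and extended by [MR3338302,kaletha:_endos_class_repres], one attaches a global $A$-parameter to $\sigma$. These works depend on the stabilisation of the twisted trace formula which has been established by a series of works by Mœglin and Waldspurger. We refer the readers to their books [MR3823813,MR3823814]. Via the Shimura–Waldspurger" p0003:L8 "Via the Shimura–Waldspurger" p0003:L9-12 "correspondence of the metaplectic group $\Mp_{2n} (\AA)$, which is the non-trivial double cover of the symplectic group $\Sp_{2n} (\AA)$, and odd special orthogonal groups, Gan and Ichino [MR3866889] also attached global $A$-parameters to genuine automorphic representations of $\Mp_{2n} (\AA)$ in the discrete spectrum. This depends on the choice of an additive character $\psi$ that is used in the Shimura–Waldspurger correspondence. In this introduction, we also let $G$ denote $\Mp_{2n}$ by" — for the paper's own results (the metaplectic case only) the global A-parameter φ_ψ(σ) is Gan – Ichino's: §2 p0008:L3-5 "We recall the description of $A$-parameters attached to genuine irreducible cuspidal automorphic representations of metaplectic groups from [MR3866889]. The $A$-parameters are defined via those attached to irreducible automorphic representations of odd special orthogonal groups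 via Shimura–Waldspurger correspondence. In this section, we write $\Mp_{2n}$ rather than $\til {G} (X)$." p0008:L61-64 "for almost all $v$. We note here that for a genuine irreducible automorphic representation of the metaplectic group, its $L$-parameter depends on the choice of an additive character $\psi$. If one changes $\psi$ to $\psi_a := \psi (a\cdot)$, the $L$-parameter changes in the way prescribed in [MR3866889]. See also [gan:_repres_metap_group_i]. Then we have the decomposition:" p0008:L66 "Theorem 2.1 ( [MR3866889])." — [MR3866889] = row C1, Theorem 1.1 (the decomposition of L²_disc(Mp_2n) into near-equivalence classes indexed by elliptic A-parameters) ↦ `Consumers.GanIchino11` (tranche 1: ⇐ book).  [MR3135650] / [MR3338302] / [kaletha:_endos_class_repres] (the book, Mok, KMSW) frame the classical-group setting of the paper's predecessors (the symplectic analogue [MR3805648] = Jiang – Wu, the unitary [MR3435720, wu21]) and are not invoked for Mp: NOT premises (the book enters through C1's edge); Mœglin 1997, Kudla – Rallis, Langlands (Eisenstein series), Arthur's truncation [MR558260, MR518111] (analytic, not the classification), [gan:_repres_metap_group_i] = B112 (the ψ-dependence, context): published, absorbed.  Premise: `GanIchino11`. [cite: Wu2022MpChiB, Thm 1 with §1 (p0003:L5-12),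 §2 Thm 2.1 (p0008:L3-5, L61-66); GanIchino2018, Thm 1.1, as [MR3866889]] -/
def E_WuMpChiB : Prop := c.GanIchino11 → c₅₈.WuMpChiB

/-- C39 ⇐ THE BOOK (SO_5) ∧ C2 (Mp_4) (`paper:arxiv-2010.08736`).  THE TWO MULTIPLICITY FORMULAE: p0003:L61-64 "Let us recall the history and the statement of the multiplicity formulae briefly. After Shimura's result [shi], Waldspurger [wal1, wal2] studied Shimura's correspondence in the framework of automorphic representations of the metaplectic group $\Mp_2$, which is a nonlinear two-fold covering group of $\Sp_2=\SL_2$. Namely, he described the automorphic discrete spectrum of $\Mp_2$ in terms of that of $\SO_3=\PGL_2$ via the global theta lifts between $\Mp_2$ and (inner forms of) $\SO_3$. About 30 years after that, Gan-Ichino [gi18, gi20] studied the automorphic discrete spectrum $L^2_{\mathrm{disc}}(\Mp_{2n})$ of the metaplectic group $\Mp_{2n}$, which is a nonlinear two-fold covering group of the symplectic group $\Sp_{2n}$ of rank $n$, and partially proved the following decomposition predicted by Gan [gan]:" […] p0003:L74 "In [gi18], they partially proved the decomposition (gi) for any rank $n$, and later, in the other paper [gi20], they completely proved it in the case that the rank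 $n$ is 2." […] p0003:L76-77 "In both papers, they used the theta correspondence and Arthur's result [art]. Here, the result of Arthur that Gan-Ichino used is a decomposition" [L²_disc(SO_2n+1) = ⊕_φ ⊕_η n_{φ,η} σ_{φ,η}] p0003:L85 "We review the multiplicity formulae for the automorphic discrete spectrum of $\SO_5$ given by Arthur and of $\Mp_4$ given by Gan-Ichino in (MF) more precisely." — THE USE: p0004:L30-32 "On the one hand, we consider the adelic lift of each Hecke eigenform in $S_{\det^{j+3} \Sym_{2k-6}} \left( \Sp_4(\Z) \right)$ to $\GSp_4(\A_\Q)$ in the usual way. It can be seen that the adelic lift is an irreducible cuspidal automorphic representation of $\GSp_4(\A_\Q)$ with trivial central character, and it is known that there is an accidental isomorphism $\PGSp_4 \cong \SO_5$, so we obtain an irreducible cuspidal automorphic representation of $\SO_5(\A_\Q)$. Thus by Arthur's multiplicity formula, we can attach an elliptic $A$-parameter for $\SO_5$ to any Hecke eigenform in $S_{\det^{j+3} \Sym_{2k-6}} \left( \Sp_4(\Z) \right)$." […] p0004:L42 "In addition, by Gan-Ichino's multiplicity formula, we can attach an elliptic $A$-parameter for $\SO_5$ to a Hecke eigenform in $J_{\det^k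 \Sym_j,1}^{\star, \mathrm{cusp}}$." §3 p0009:L3 "In this section, we recall the multiplicity formulae for split $\SO_5$ [art] and $\Mp_4$ [gi18, gi20]." p0010:L13 "Recall that $\Pi_{\phi_v}(\SO_5)$, given by Arthur [art], is a finite set" […] p0010:L20 "of semisimple representations of $\SO_5(F_v)$ of finite length indexed by characters of $S_{\phi_v}$, and $\Pi_{\phi_v, \psi_v}(\Mp_4)$, given by Gan-Ichino [gi18, gi20], is a finite set" […] p0010:L59 "Then the multiplicity formulae for $\SO_5$ and $\Mp_4$ are stated as follows." p0010:L61-62 "Theorem 3.1 ( [art]). For every elliptic $A$-parameter $\phi$ for $\SO_5$, put" […] p0010:L80-81 "Theorem 3.2 ( [gi20]). For every elliptic $A$-parameter $\phi$ for $\Mp_4$, put" […] — [art] Theorem 3.1 (Arthur's multiplicity formula for the split SO_5 = the book's Theorem 1.5.2, with the local packets Π_{φ_v}(SO_5) and the character ε_φ) ↦ the book at all ranks (`∀ N, ν.Everything N`); [gi20] Theorem 3.2 = row C2 (Gan – Ichino, IMRN 2021, Theorem 2.1: the full discrete spectrum of Mp_4) ↦ `Consumers5.GanIchinoMp4` (tranche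 5: ⇐ book ∧ C1's Theorems 1.1 / 1.4); [gi18] = row C1 (the local packets Π_{φ_v,ψ_v}(Mp_4), the partial decomposition) reaches the edge through C2's own premises; the accidental isomorphism PGSp_4 ≅ SO_5, the Jacobi-group representation theory (the author's §§4–6), Shimura, Waldspurger [wal1, wal2], [mr1, mr2] (Mœglin – Renard at the real place): published, absorbed.  Premises: the book (all ranks), `GanIchinoMp4`. [cite: Ishimoto2022Ibukiyama, Thms 1.1–1.3 with §1 (p0003:L61-64, L74-77, L85, p0004:L30-32, L42), §3 (p0009:L3, p0010:L13-20, Thm 3.1 p0010:L61-62, Thm 3.2 p0010:L80-81); Arthur2013, Thm 1.5.2, as [art]; GanIchino2020, Thm 2.1, as [gi20]] -/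
def E_IshimotoIbukiyama : Prop := (∀ N, ν.Everything N) → c₅.GanIchinoMp4 → c₅₈.IshimotoIbukiyama

/-- C121 ⇐ THE BOOK (SO_5) ∧ C2 (Mp_4) ∧ C39 (`paper:arxiv-2312.06921`).  §7 p0050:L41-43 "7 Multiplicity formulae for SO5 and Mp4 In this section, we review the multiplicity formulae for the split SO5 and Mp4 briefly. See [4] (for the split SO5) and [6, 7] (for Mp 4) for mor detail. As in [16], they play important roles in this paper." […] p0050:L46 "for SO 5 and for Mp 4 are the same. Recall from [4, 6, 7] that an elliptic A-parameter for SO 5 or Mp 4 is a" […] p0051:L9-10 "with a formal basis {ai} such that ai corresponds to ϕi ⊠ Sdi . Recall also that Arthur [4] associated a character ϵϕ of Sϕ with ϕ, and Gan-Ichino [7] did another character eϵϕ." […] p0051:L37 "case of Mp 4). Recall that Π ϕv (SO5), given by Arthur [4], is a finite set" […] p0054:L4 "given by Gan-Ichino [6, 7], is a finite set" […] p0060:L37-39 "of SO 5(AF ) and Mp 4(AF ), respectively. Then the multiplicity formulae for SO 5 and Mp 4 can be stated as follows. Theorem 7.1 ([4, Theorem 1.5.2]) . For every elliptic A-parameter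 ϕ for SO5, put" […] p0060:L60 "Theorem 7.2 ([7, Theorem 2.1]) . For every elliptic A-parameter ϕ for Mp4, put" […] — [4, Theorem 1.5.2] = the book's multiplicity formula (SO_5 ⊂ all ranks ↦ `∀ N, ν.Everything N`), used e.g. at p0062:L14-15 "(8.2) at the real place, and is trivial at every finite places. However, since ϕF is tempered, Arthur’s character ϵϕF is trivial. These contradict the multiplicity formula (Theorem 7.1)."; [7, Theorem 2.1] = row C2 ↦ `Consumers5.GanIchinoMp4`; [6] = row C1 (the local packets Π_{φ_v,ψ_v}(Mp_4) « given by Gan-Ichino [6, 7] », [6, Proposition 4.1] at p0065:L125) reaches the edge through C2's premises; [16] = row C39 (the model of the proof, p0003:L50, and its Theorems 2.1 / 2.3 used in §6's compositions, p0050:L39-40) ↦ `IshimotoIbukiyama`; p0067:L45 "In this subsection, we finally complete the proofs of the main theorems (Theorem 4.1, 4.2, 4.3, and 6.1)."  [10] (Gan – Takeda, theta for GSp_4), [2, 3, 8] (local Langlands for GSp_4 / real groups), Mœglin – Renard at the real place: published, absorbed.  Premises: the book (all ranks), `GanIchinoMp4`, `IshimotoIbukiyama`. [cite: Ishimoto2023IbukiyamaDS,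 Thms 4.1–4.3, 6.1 with §7 (p0050:L41-46, p0051:L9-10, L37, p0054:L4, Thm 7.1 p0060:L37-39, Thm 7.2 p0060:L60), §8 (p0062:L14-15, p0067:L45); Arthur2013, Thm 1.5.2, as [4]; GanIchino2020, Thm 2.1, as [7]; Ishimoto2022Ibukiyama, as [16]] -/
def E_IshimotoIbukiyamaDS : Prop :=
  (∀ N, ν.Everything N) → c₅.GanIchinoMp4 → c₅₈.IshimotoIbukiyama → c₅₈.IshimotoIbukiyamaDS

/-- C201 ⇐ THE BOOK (`paper:arxiv-2401.06624`).  ONE LOCUS, inside the proof sketch of Theorem 6.1: p0013:L26 "The image of $B^Aut_ $ is $\Sigma$, by multiplicity one for $G'= _2a$ (at least for tempered A-packets, since $\Sigma$ is globally generic) [Ar]." — the book's multiplicity one in the automorphic discrete spectrum of Sp_2a (Theorem 1.5.2) for the generic, hence tempered-type, parameter of Σ, every a ≥ 1 ↦ `∀ N, ν.Everything N`; then p0013:L57 "By multiplicity one, we have factorisations" […]; p0013:L55 "To summarise, we have two main results ((eq:Global)) and ((eq:Local)), with ((eq:Local)) the local analog of the global ((eq:Global))."  The theorem's printed hypotheses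 ([LM] = Lapid – Mao's Whittaker-period conj. for Sp_2a; a local multiplicity one « the less serious hypothesis ») concern other inputs and are part of the statement AS STATED (not Arthur-type nodes); [W] / [GW] / [GW2] (the authors' earlier papers), [BZSV], [SV], Howe duality, the Rallis inner product / Siegel – Weil machinery: published or the authors' own, absorbed.  No [Mok] / KMSW.  Premise: the book (all ranks). [cite: GanWang2026WhittakerII, Thm 6.1 (p0013:L7-13) with its proof sketch (p0013:L26, L55-57); Arthur2013, Thm 1.5.2, as [Ar]] -/
def E_GanWangPeriod : Prop := (∀ N, ν.Everything N) → c₅₈.GanWangPeriod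

/-- The fifty-eighth tranche of implications: C77's second-order edge, C39's, C121's, C201's. [cite: Wu2022MpChiB, Thm 1; Ishimoto2022Ibukiyama, Thms 1.1–1.3; Ishimoto2023IbukiyamaDS, Thms 4.1–4.3, 6.1; GanWang2026WhittakerII, Thm 6.1 (each edge's source in its own docstring)] -/
structure Implications58 : Prop where
  wu : E_WuMpChiB c c₅₈
  ibukiyama : E_IshimotoIbukiyama ν c₅ c₅₈
  ibukiyamaDS : E_IshimotoIbukiyamaDS ν c₅ c₅₈
  ganWang : E_GanWangPeriod ν c₅₈

variable {ν μ κ c c₂ c₅ c₅₈}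

/-- C77 FROM C1, as typed (second order). [cite: Wu2022MpChiB, Thm 1 with §2 (bookkeeping proved here)] -/
theorem wuMpChiB_of_C1 (W : Implications58 ν c c₅ c₅₈) (h : c.GanIchino11) : c₅₈.WuMpChiB :=
  W.wu h

/-- THE TRANCHE FROM THE BOOK'S INPUTS: with tranche 1's edges (C1 ⇐ book) and tranche 5's (C2 ⇐ book ∧ C1), all four
statements follow from `BookInputs` alone — C77 through C1, C39 / C121 through the SO_5 multiplicity formula and through C2,
C201 directly. [cite: Wu2022MpChiB, Thm 1; Ishimoto2022Ibukiyama, Thms 1.1–1.3; Ishimoto2023IbukiyamaDS, Thm 6.1; GanWang2026WhittakerII, Thm 6.1 (bookkeeping proved here)] -/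
theorem mpGlobal_of_inputs (W : Implications58 ν c c₅ c₅₈) (I : Implications ν μ κ c) (V : Implications5 ν μ κ c c₂ c₅)
    (A : BookInputs ν) :
    c₅₈.WuMpChiB ∧ c₅₈.IshimotoIbukiyama ∧ c₅₈.IshimotoIbukiyamaDS ∧ c₅₈.GanWangPeriod :=
  have b := A.everything
  have mp4 := ganIchinoMp4_of_leaves I V A
  have k := W.ibukiyama b mp4
  ⟨W.wu (ganIchino11_of_leaves I A), k, W.ibukiyamaDS b mp4 k, W.ganWang b⟩

/-- THE TRANCHE IN CONDITIONAL FORM, 2026: granting the book's edges, supply edges and every PUBLISHED input, tranche 1's and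
tranche 5's edges, the four statements follow from the book's seven 2024–2026 PREPRINT leaves and its two UNWRITTEN weighted
lemmas; no Mok / KMSW residue.  C77 prints the Mœglin – Waldspurger stabilisation sentence (for the book, Mok and KMSW alike);
C39, C121, C201 print no sentence on the status of the classification. [cite: Wu2022MpChiB, p0003:L6-8; Ishimoto2022Ibukiyama, p0003:L76; Ishimoto2023IbukiyamaDS, p0060:L39; GanWang2026WhittakerII, p0013:L26 (bookkeeping proved here)] -/
theorem mpGlobal_conditional_form (W : Implications58 ν c c₅ c₅₈) (I : Implications ν μ κ c) (V : Implications5 ν μ κ c c₂ c₅)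
    (B : ν.BookEdges) (S : ν.SupplyEdges) (P : ν.PublishedLeaves) :
    ν.PreprintLeaves2026 → ν.UnwrittenLeaves →
      c₅₈.WuMpChiB ∧ c₅₈.IshimotoIbukiyama ∧ c₅₈.IshimotoIbukiyamaDS ∧ c₅₈.GanWangPeriod :=
  fun Q U => mpGlobal_of_inputs W I V ⟨B, S, P, Q, U⟩

end Downstream

end Literature.NumberTheory.Automorphic.Arthur2013
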